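import Mathlib.Analysis.Convex.Function
import Literature.MathematicalPhysics.QuantumLattice.InfVolFermionStateBounds
import Literature.MathematicalPhysics.QuantumLattice.HubbardFermionInteractionTerms
import Literature.MathematicalPhysics.QuantumLattice.HubbardNNNHoppingInteraction
import Literature.MathematicalPhysics.QuantumLattice.FermionGroundStatesMinimiseMeanEnergy
import Literature.MathematicalPhysics.QuantumLattice.FermionOperatorsProofs
import Literature.MathematicalPhysics.QuantumLattice.PairCorrelationsProofs
import HarnessLib

/-!
# The translation-invariant ground-state energy density of a perturbed lattice fermion
# interaction `Ψ₀ + s·Ψ₁`: concavity, Lipschitz continuity, and the Griffiths–Hellmann–Feynman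
# response brackets on the conjugate density from energy windows at neighbouring couplings

Topic `Literature/MathematicalPhysics/QuantumLattice`; namespace
`Literature.MathematicalPhysics.QuantumLattice` (the file path). Companion of
`InfVolFermionState.lean` §6 (`FermionInteraction`, `meanEnergy`, `IsMeanEnergyMinimiser`),
`HubbardTTPrimeMeanEnergySupergradient.lean` (the torus-limit reading of the supergradient for the
`t'`- and `U`-directions of the `t–t'` Hubbard model) and `GroundStateSourceBounds.lean` (the
finite-volume tracial-ground-state energy sandwich for `K − hO`). Written for the certified
"pinning-field response" programme (Hubbard ladder, rung CQ (c-2): Hellmann–Feynman brackets on an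
order-parameter density from certified ground-state energy windows at the sources `h`, `h ± δ`) and
for the `μ`-direction (density of a ground state of `H − μN` from energy windows at `μ ± δ`).

## Contents

Everything is PROVED; the definitions (`pencil`, `tiGroundEnergyDensity`, `numberInteraction`,
`hubbardTTPrimeMuInteraction`, `singletPairAt`, `pairSourceInteraction`, `hubbardTTPrimeSourcedInteraction`)
have bodies; no named fact.

§1 The pencil `FermionInteraction.pencil Ψ₀ Ψ₁ s = Ψ₀ + s·Ψ₁` of two interactions on `ℤ^d`
(termwise), its local Hamiltonians / mean-energy observable / mean energy (all affine in `s`: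
`meanEnergy_pencil`), evenness and hermiticity.

§2 `FermionInteraction.tiGroundEnergyDensity Ψ R = inf {e_Ψ(ω) : ω translation invariant}` — the
translation-invariant (variational) ground-state energy density of an interaction (Bratteli–Kishimoto–
Robinson 1978 Thm. 2: for quantum spin systems its minimisers are exactly the translation-invariant
ground states; the tree's `IsMeanEnergyMinimiser Ψ R ω` says `ω` attains it,
`isMeanEnergyMinimiser_iff`). Basic API: it is a lower bound (`tiGroundEnergyDensity_le_meanEnergy`),
the greatest one (`le_tiGroundEnergyDensity`), finite (`abs_meanEnergy_le_norm`, the vacuum is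
translation invariant).

§3 Along a pencil `s ↦ e₀(s) := tiGroundEnergyDensity (pencil Ψ₀ Ψ₁ s) R` is CONCAVE on `ℝ`
(`concaveOn_tiGroundEnergyDensity_pencil`; an infimum of affine functions — Israel 1979 Thm. I.3.4 /
Ruelle 1969 §3.4 for the pressure, Koma–Tasaki 1994 §1 for ground-state energies) and
`‖E_{Ψ₁}‖`-Lipschitz (`abs_tiGroundEnergyDensity_pencil_sub_le`).

§4 RESPONSE BRACKETS (Griffiths 1966 §II–III; Koma–Tasaki 1994 §1; the zero-temperature
Hellmann–Feynman / supergradient inequalities). For EVERY translation-invariant state `ω` and every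
`δ > 0`, writing `E_s(ω) = e_{Ψ₀ + sΨ₁}(ω)` and `φ(ω) = e_{Ψ₁}(ω)` (the conjugate density):
`E_{s±δ}(ω) = E_s(ω) ± δ φ(ω)` (`meanEnergy_pencil_add`), hence from ANY lower bounds
`lo₊ ≤ E_{s+δ}(ω)`, `lo₋ ≤ E_{s−δ}(ω)` (e.g. certified lower bounds valid for all translation-invariant
states, or `e₀(s ± δ)` itself) and ANY upper bound `E_s(ω) ≤ hi`:
`(lo₊ − hi)/δ ≤ φ(ω) ≤ (hi − lo₋)/δ` (`div_le_meanEnergy_of_bounds`, `meanEnergy_le_div_of_bounds`).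
For a MINIMISER `ω` at `s` one may take `hi = e₀(s)` (or any certified upper bound on it, e.g. the mean
energy of a translation-invariant trial state) and `lo± = e₀(s ± δ)`: the secant brackets
`(e₀(s+δ) − e₀(s))/δ ≤ φ(ω) ≤ (e₀(s) − e₀(s−δ))/δ` (`IsMeanEnergyMinimiser.secant_right_le_meanEnergy`,
`IsMeanEnergyMinimiser.meanEnergy_le_secant_left`), the supergradient inequality
`e₀(s') ≤ e₀(s) + (s' − s) φ(ω)` (`IsMeanEnergyMinimiser.tiGroundEnergyDensity_le_affine`) and
antitonicity of `φ` along minimisers (`IsMeanEnergyMinimiser.meanEnergy_antitone`). For an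
`ε`-approximate minimiser (`E_s(ω) ≤ e₀(s) + ε`, the content of an energy-capped relaxation) the
brackets widen by `ε/δ` on each side (`div_le_meanEnergy_of_approxMinimiser`, `…le_div…`); optimising
`δ` against a curvature bound is the origin of the `2√(2χε)` window law quoted in planning documents —
not formalised here (no curvature hypothesis is certified).

§5 The particle-number interaction `numberInteraction d` (`Φ {x} = n_{x↑} + n_{x↓}`), whose mean
energy is the density (`meanEnergy_numberInteraction`), and the `μ`-pencil of the `t–t'` Hubbard model
`hubbardTTPrimeMuInteraction t t' U μ = Φ(t,t',U) − μ·n` (`= pencil Φ(t,t',U) n (−μ)` termwise):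
its mean energy is `e^{tt'}(ω) − μ ρ(ω)` (`meanEnergy_hubbardTTPrimeMu`); every translation-invariant
state satisfying the Bratteli–Robinson ground-state condition for `H(t,t',U) − μN` (the hypothesis
`hgs` of `FermionGroundStatesMinimiseMeanEnergy.lean`) is a minimiser of the `μ`-pencil
(`isMeanEnergyMinimiser_hubbardTTPrimeMu_of_groundState`), so its DENSITY obeys the `μ`-secant
brackets of the grand-canonical energy density `e_GC(μ) = tiGroundEnergyDensity (Φ − μn) 1`
(`density_mem_secant_brackets_of_groundState`): `(e_GC(μ−δ) − e_GC(μ))/δ ≤ ρ(ω) ≤ (e_GC(μ) − e_GC(μ+δ))/δ`.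

§6 The singlet PAIR-SOURCE interaction `pairSourceInteraction g` on `ℤ²` (Koma–Tasaki's order operator
`O = Δ_g + Δ_g†` as a range-`1` interaction: on-site `(g 0/√2)(b_{x,x} + h.c.)`, bonds
`√2 g(e_i)(b_{x,x+e_i} + h.c.)`, `b_{x,y} = c_{x↑}c_{y↓} − c_{x↓}c_{y↑}` = `singletPairAt`), even and
Hermitian, with its mean-energy observable in closed form (`pairSourceInteraction_meanEnergyObs`) and the
PAIR AMPLITUDE `e_P(ω) = meanEnergy (pairSourceInteraction g) 1 ω` of a state spelled out in local
expectations (`meanEnergy_pairSourceInteraction_eq`).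

§7 The pair-sourced grand-canonical `t–t'` Hubbard interaction
`hubbardTTPrimeSourcedInteraction t t' U μ g h = Φ(t,t',U) − μn − hP_g` (any `t'`; the tree's torus /
window objects `dWaveSourceTorus`, `pairSourceWindowHamiltonian` are the `t' = 0`, `g = dWaveFormFactor`
case), `e^{src}_h(ω) = e^{tt'}(ω) − μρ(ω) − h e_P(ω)` (`meanEnergy_hubbardTTPrimeSourced`), concavity in
`h` (`concaveOn_tiGroundEnergyDensity_sourced`), and the BRACKETS ON THE INDUCED PAIR AMPLITUDE by name:
FLOOR from the left neighbour `(lo(h−δ) − hi(h))/δ ≤ e_P(ω)` (`div_le_pairAmplitude_of_bounds`; with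
`δ = h` a source-FREE certified lower bound and one sourced variational upper bound suffice), CEILING
from the right neighbour `e_P(ω) ≤ (hi(h) − lo(h+δ))/δ` (`pairAmplitude_le_div_of_bounds`), the two-sided
certified form (`pairAmplitude_mem_Icc_of_bounds`, `IsMeanEnergyMinimiser.pairAmplitude_mem_Icc_of_bounds`),
the secant brackets and monotonicity in `h` for minimisers
(`IsMeanEnergyMinimiser.pairAmplitude_mem_secant_brackets`, `.pairAmplitude_mono`).

§8 The dictionary `e_P(ω) = 2 Re ω(P₀)` with the tree's infinite-lattice local pair
`P₀ = localPairAt ({0} ∪ unitSteps) g 0` (`meanEnergy_pairSourceInteraction_eq_two_mul_re_expect_localPairAt`,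
`g` even on the unit steps; `meanEnergy_pairSourceInteraction_dWave_eq`).

§9 `e_GC(μ) ≤ energyDensityTT' t t' U n − μn` for every `n ∈ [0,2)` (`U ≥ 0`): certified CANONICAL upper
rows feed the `hhi` slot of the `μ`-brackets, grand-canonical lower bounds are supporting lines of the
canonical density (`tiGroundEnergyDensity_hubbardTTPrimeMu_le_energyDensityTT'_sub`,
`…_le_of_energyDensityTT'_le`, `add_mul_le_energyDensityTT'_of_forall_le_meanEnergy_hubbardTTPrimeMu`), and the
transported cap for the sourced model (`tiGroundEnergyDensity_sourced_le_of_pairAmplitude_eq_zero`).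

## What is NOT here (honest scope)

* No identification of `tiGroundEnergyDensity` with a torus limit `lim E₀(H_L)/L^d` (for the
  canonical `t–t'` model the tree has `IsTranslationInvariant.energyDensityTT'_le_meanEnergy` and
  `IsTorusLimitOf.meanEnergy_hubbardTTPrime_eq_energyDensityTT'`; the grand-canonical / sourced
  analogue is not proved here).
* §8 identifies the pair amplitude with the local pair operator at the origin
  (`meanEnergy_pairSourceInteraction_eq_two_mul_re_expect_localPairAt`: `e_P(ω) = 2 Re ω(P₀)`,
  `P₀ = localPairAt ({0} ∪ unitSteps) g 0`, for `g` even on the unit steps); but there is no operator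
  identity between `(pairSourceInteraction g).localHamiltonian Λ` and the tree's window source
  `pairSourceWindow g Λ + (pairSourceWindow g Λ)ᴴ` (they agree bond by bond for even `g`; not proved
  here), and no Bratteli–Robinson-ground-state ⇒ minimiser theorem for the SOURCED model (the
  `μ`-pencil case is `isMeanEnergyMinimiser_hubbardTTPrimeMu_of_groundState`; the sourced analogue needs
  the crossing-term bound of `FermionGroundStatesMinimiseMeanEnergy.lean` for the pair bonds).
* A finite-`h` floor on the induced pair amplitude is NOT a floor on the `h → 0⁺` order parameter or on
  long-range order (the amplitude is non-decreasing in `h`; Koma–Tasaki's theorems go LRO ⇒ response).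
* Lower bounds `lo±` fed to §4 must be valid for the state at hand: stationarity ("eom"/"kkt") rows of
  `H(s ± δ)` are NOT licensed for a ground state of `H(s)`; positivity, translation and symmetry nulls
  the state has are.

## References

* R. B. Griffiths, *Spontaneous magnetization in idealized ferromagnets*, Phys. Rev. 152 (1966)
  240–246, §II–III (one-sided derivatives of a concave thermodynamic function bound the conjugate
  order parameter in every equilibrium / ground state). [cite: Griffiths1966, §II]
* T. Koma, H. Tasaki, *Symmetry breaking and finite-size effects in quantum many-body systems*,
  J. Stat. Phys. 76 (1994) 745–803, §1 (order parameters from a symmetry-breaking source `H − hO`;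
  the energy is concave in `h`). [cite: KomaTasaki1994, §1]
* R. B. Israel, *Convexity in the Theory of Lattice Gases*, Princeton 1979, Thm. I.3.4 (the pressure
  is convex and `1`-Lipschitz in the interaction norm). [cite: Israel1979, Thm. I.3.4]
* O. Bratteli, A. Kishimoto, D. W. Robinson, Commun. Math. Phys. 64 (1978) 41–48, §3 and Thm. 2
  (mean energy of translation-invariant states; minimisers = translation-invariant ground states).
  [cite: BratteliKishimotoRobinson1978, Thm. 2]
* D. Ruelle, *Statistical Mechanics: Rigorous Results* (1969), §3.4. [cite: Ruelle1969, §3.4]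
-/

noncomputable section

namespace Literature.MathematicalPhysics.QuantumLattice

open Matrix Finset HubbardWave0 Literature.Probability.LatticeModels
open scoped ComplexOrder

variable {d : ℕ}

/-! ### §1. Pencils of interactions -/

namespace FermionInteraction

/-- **The pencil `Ψ₀ + s·Ψ₁` of two interactions** (termwise: `Φ X = Φ₀ X + s Φ₁ X`): a
one-parameter family of Hamiltonians `H(s) = H₀ + s H₁`, `H₁` the "conjugate" perturbation
(a source `−hO` is the pencil with `Ψ₁ = O`, `s = −h`). Koma–Tasaki (1994) §1 (`H_Λ − h O_Λ`);
Griffiths (1966) §II. [cite: KomaTasaki1994, §1] -/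
def pencil (Ψ₀ Ψ₁ : FermionInteraction d) (s : ℝ) : FermionInteraction d where
  Φ X := Ψ₀.Φ X + (s : ℂ) • Ψ₁.Φ X

variable (Ψ₀ Ψ₁ : FermionInteraction d) (s : ℝ)

/-- The terms of the pencil (definitional). [cite: KomaTasaki1994, §1] -/
theorem pencil_apply (X : Finset (Site d)) : (pencil Ψ₀ Ψ₁ s).Φ X = Ψ₀.Φ X + (s : ℂ) • Ψ₁.Φ X := rfl

/-- At `s = 0` the pencil has the terms of `Ψ₀`. [cite: KomaTasaki1994, §1] -/
theorem pencil_zero_apply (X : Finset (Site d)) : (pencil Ψ₀ Ψ₁ 0).Φ X = Ψ₀.Φ X := by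
  rw [pencil_apply, Complex.ofReal_zero, zero_smul, add_zero]

/-- A pencil of even interactions is even. [cite: ArakiMoriya2003, §1 assumption (II)] -/
theorem isEven_pencil {Ψ₀ Ψ₁ : FermionInteraction d} (h₀ : Ψ₀.IsEven) (h₁ : Ψ₁.IsEven) (s : ℝ) :
    (pencil Ψ₀ Ψ₁ s).IsEven := fun X => by
  rw [pencil_apply, map_add, map_smul, h₀ X, h₁ X]

/-- A real pencil of Hermitian interactions is Hermitian. [cite: ArakiMoriya2003, §1 assumption (II)] -/
theorem isHermitian_pencil {Ψ₀ Ψ₁ : FermionInteraction d} (h₀ : Ψ₀.IsHermitian) (h₁ : Ψ₁.IsHermitian)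
    (s : ℝ) : (pencil Ψ₀ Ψ₁ s).IsHermitian := fun X => by
  unfold Matrix.IsHermitian
  rw [pencil_apply, Matrix.conjTranspose_add, Matrix.conjTranspose_smul, (h₀ X).eq, (h₁ X).eq,
    Complex.star_def, Complex.conj_ofReal]

/-- A pencil of interactions of range `R` has range `R`. [cite: ArakiMoriya2003, §5.4] -/
theorem hasFiniteRange_pencil {Ψ₀ Ψ₁ : FermionInteraction d} {R : ℝ} (h₀ : Ψ₀.HasFiniteRange R)
    (h₁ : Ψ₁.HasFiniteRange R) (s : ℝ) : (pencil Ψ₀ Ψ₁ s).HasFiniteRange R := fun X hX => by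
  rw [pencil_apply, h₀ X hX, h₁ X hX, smul_zero, add_zero]

/-- A pencil of translation-covariant interactions is translation covariant.
[cite: ArakiMoriya2003, §1 assumption (IV)] -/
theorem isTranslationInvariant_pencil {Ψ₀ Ψ₁ : FermionInteraction d} (h₀ : Ψ₀.IsTranslationInvariant)
    (h₁ : Ψ₁.IsTranslationInvariant) (s : ℝ) : (pencil Ψ₀ Ψ₁ s).IsTranslationInvariant := fun v X => by
  rw [pencil_apply, pencil_apply, h₀ v X, h₁ v X, map_add, map_smul]

/-- **The local Hamiltonians of the pencil are `H₀ + s H₁`.** [cite: KomaTasaki1994, §1] -/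
theorem localHamiltonian_pencil (Λ : Finset (Site d)) :
    (pencil Ψ₀ Ψ₁ s).localHamiltonian Λ = Ψ₀.localHamiltonian Λ + (s : ℂ) • Ψ₁.localHamiltonian Λ := by
  unfold localHamiltonian
  rw [Finset.smul_sum, ← Finset.sum_add_distrib]
  exact Finset.sum_congr rfl fun X _ => by rw [pencil_apply, map_add, map_smul]

/-- **The mean-energy observable of the pencil is `E_{Ψ₀} + s E_{Ψ₁}`.**
[cite: BratteliKishimotoRobinson1978, §3 (mean energy functional)] -/
theorem meanEnergyObs_pencil (R : ℝ) :
    (pencil Ψ₀ Ψ₁ s).meanEnergyObs R = Ψ₀.meanEnergyObs R + (s : ℂ) • Ψ₁.meanEnergyObs R := by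
  unfold meanEnergyObs
  rw [Finset.smul_sum, ← Finset.sum_add_distrib]
  exact Finset.sum_congr rfl fun X _ => by rw [pencil_apply, map_add, map_smul, smul_add, smul_comm]

end FermionInteraction

namespace InfVolFermionState

variable (ω : InfVolFermionState d)

/-- **The mean energy is affine along a pencil**: `e_{Ψ₀ + sΨ₁}(ω) = e_{Ψ₀}(ω) + s·e_{Ψ₁}(ω)` for
every infinite-volume state `ω` — `e_{Ψ₁}(ω)` is the CONJUGATE DENSITY of the perturbation in the
state `ω`. [cite: BratteliKishimotoRobinson1978, §3 (mean energy functional)] -/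
theorem meanEnergy_pencil (Ψ₀ Ψ₁ : FermionInteraction d) (s R : ℝ) :
    ω.meanEnergy (FermionInteraction.pencil Ψ₀ Ψ₁ s) R = ω.meanEnergy Ψ₀ R + s * ω.meanEnergy Ψ₁ R := by
  unfold InfVolFermionState.meanEnergy
  rw [FermionInteraction.meanEnergyObs_pencil, map_add, map_smul, smul_eq_mul, Complex.add_re,
    Complex.re_ofReal_mul]

/-- **Shifting the coupling**: `e_{Ψ₀ + s'Ψ₁}(ω) = e_{Ψ₀ + sΨ₁}(ω) + (s' − s)·e_{Ψ₁}(ω)`.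
[cite: KomaTasaki1994, §1] -/
theorem meanEnergy_pencil_eq_add_sub_mul (Ψ₀ Ψ₁ : FermionInteraction d) (s s' R : ℝ) :
    ω.meanEnergy (FermionInteraction.pencil Ψ₀ Ψ₁ s') R =
      ω.meanEnergy (FermionInteraction.pencil Ψ₀ Ψ₁ s) R + (s' - s) * ω.meanEnergy Ψ₁ R := by
  rw [meanEnergy_pencil, meanEnergy_pencil]
  ring

open scoped Matrix.Norms.L2Operator in
/-- **A priori bound**: `|e_Ψ(ω)| ≤ ‖E_Ψ‖` (states are contractive, Bratteli–Robinson I Prop. 2.3.11).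
[cite: BratteliRobinsonI1987, Prop. 2.3.11] -/
theorem abs_meanEnergy_le_norm (Ψ : FermionInteraction d) (R : ℝ) :
    |ω.meanEnergy Ψ R| ≤ ‖Ψ.meanEnergyObs R‖ :=
  ω.abs_re_expect_le _ _

end InfVolFermionState

/-! ### §2. The translation-invariant ground-state energy density -/

namespace FermionInteraction

/-- **The translation-invariant (variational) ground-state energy density** of an interaction:
`e₀(Ψ) = inf { e_Ψ(ω) : ω a translation-invariant state of the CAR algebra over ℤ^d }`, `e_Ψ(ω)` the
mean energy at range parameter `R` (`InfVolFermionState.meanEnergy`). Its minimisers are the tree's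
`IsMeanEnergyMinimiser Ψ R` (`isMeanEnergyMinimiser_iff`); for quantum spin systems these are exactly
the translation-invariant ground states (Bratteli–Kishimoto–Robinson 1978, Thm. 2), for the `t–t'`
Hubbard model with a chemical potential every translation-invariant Bratteli–Robinson ground state is
one (`FermionGroundStatesMinimiseMeanEnergy.lean`). [cite: BratteliKishimotoRobinson1978, Thm. 2 (condition 2)] -/
def tiGroundEnergyDensity (Ψ : FermionInteraction d) (R : ℝ) : ℝ :=
  sInf ((fun ω : InfVolFermionState d => ω.meanEnergy Ψ R) ''
    {ω : InfVolFermionState d | ω.IsTranslationInvariant})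

variable (Ψ : FermionInteraction d) (R : ℝ)

open scoped Matrix.Norms.L2Operator in
/-- The set of mean energies of translation-invariant states is bounded below (by `−‖E_Ψ‖`).
[cite: BratteliRobinsonI1987, Prop. 2.3.11] -/
theorem bddBelow_meanEnergy_image :
    BddBelow ((fun ω : InfVolFermionState d => ω.meanEnergy Ψ R) ''
      {ω : InfVolFermionState d | ω.IsTranslationInvariant}) := by
  refine ⟨-‖Ψ.meanEnergyObs R‖, ?_⟩
  rintro _ ⟨ω, -, rfl⟩
  exact (abs_le.1 (ω.abs_meanEnergy_le_norm Ψ R)).1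

/-- The set of mean energies of translation-invariant states is non-empty (the Fock vacuum is
translation invariant). [cite: BratteliKishimotoRobinson1978, §3 (mean energy functional)] -/
theorem meanEnergy_image_nonempty :
    ((fun ω : InfVolFermionState d => ω.meanEnergy Ψ R) ''
      {ω : InfVolFermionState d | ω.IsTranslationInvariant}).Nonempty :=
  ⟨_, Set.mem_image_of_mem _ (InfVolFermionState.vacuumState_isTranslationInvariant (d := d))⟩

/-- **`e₀(Ψ)` is a lower bound**: `e₀(Ψ) ≤ e_Ψ(ω)` for every translation-invariant `ω` (the
variational principle). [cite: BratteliKishimotoRobinson1978, Thm. 2 (condition 2)] -/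
theorem tiGroundEnergyDensity_le_meanEnergy {ω : InfVolFermionState d} (hω : ω.IsTranslationInvariant) :
    Ψ.tiGroundEnergyDensity R ≤ ω.meanEnergy Ψ R :=
  csInf_le (Ψ.bddBelow_meanEnergy_image R) (Set.mem_image_of_mem _ hω)

/-- **`e₀(Ψ)` is the greatest lower bound**: a number below the mean energy of every
translation-invariant state is `≤ e₀(Ψ)` — the form in which a CERTIFIED lower bound (valid for all
translation-invariant states) is read. [cite: BratteliKishimotoRobinson1978, Thm. 2 (condition 2)] -/
theorem le_tiGroundEnergyDensity {c : ℝ}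
    (h : ∀ ω : InfVolFermionState d, ω.IsTranslationInvariant → c ≤ ω.meanEnergy Ψ R) :
    c ≤ Ψ.tiGroundEnergyDensity R :=
  le_csInf (Ψ.meanEnergy_image_nonempty R) (by
    rintro _ ⟨ω, hω, rfl⟩
    exact h ω hω)

/-- If `e₀(Ψ) < c` then some translation-invariant state has mean energy `< c` (`e₀` is an infimum).
[cite: BratteliKishimotoRobinson1978, Thm. 2 (condition 2)] -/
theorem exists_meanEnergy_lt_of_tiGroundEnergyDensity_lt {c : ℝ} (h : Ψ.tiGroundEnergyDensity R < c) :
    ∃ ω : InfVolFermionState d, ω.IsTranslationInvariant ∧ ω.meanEnergy Ψ R < c := by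
  obtain ⟨_, ⟨ω, hω, rfl⟩, hlt⟩ := (csInf_lt_iff (Ψ.bddBelow_meanEnergy_image R)
    (Ψ.meanEnergy_image_nonempty R)).1 h
  exact ⟨ω, hω, hlt⟩

open scoped Matrix.Norms.L2Operator in
/-- `−‖E_Ψ‖ ≤ e₀(Ψ)`. [cite: BratteliRobinsonI1987, Prop. 2.3.11] -/
theorem neg_norm_le_tiGroundEnergyDensity : -‖Ψ.meanEnergyObs R‖ ≤ Ψ.tiGroundEnergyDensity R :=
  Ψ.le_tiGroundEnergyDensity R fun ω _ => (abs_le.1 (ω.abs_meanEnergy_le_norm Ψ R)).1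

open scoped Matrix.Norms.L2Operator in
/-- `e₀(Ψ) ≤ ‖E_Ψ‖`. [cite: BratteliRobinsonI1987, Prop. 2.3.11] -/
theorem tiGroundEnergyDensity_le_norm : Ψ.tiGroundEnergyDensity R ≤ ‖Ψ.meanEnergyObs R‖ :=
  (Ψ.tiGroundEnergyDensity_le_meanEnergy R InfVolFermionState.vacuumState_isTranslationInvariant).trans
    (abs_le.1 ((vacuumState d).abs_meanEnergy_le_norm Ψ R)).2

end FermionInteraction

namespace InfVolFermionState

variable {Ψ : FermionInteraction d} {R : ℝ} {ω : InfVolFermionState d}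

/-- **Minimisers attain `e₀`**: `ω` minimises the mean energy iff it is translation invariant and
`e_Ψ(ω) ≤ e₀(Ψ)` (hence `= e₀(Ψ)`). [cite: BratteliKishimotoRobinson1978, Thm. 2 (condition 2)] -/
theorem isMeanEnergyMinimiser_iff :
    ω.IsMeanEnergyMinimiser Ψ R ↔
      ω.IsTranslationInvariant ∧ ω.meanEnergy Ψ R ≤ Ψ.tiGroundEnergyDensity R := by
  constructor
  · rintro ⟨hω, hmin⟩
    exact ⟨hω, Ψ.le_tiGroundEnergyDensity R hmin⟩
  · rintro ⟨hω, hle⟩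
    exact ⟨hω, fun ω' hω' => hle.trans (Ψ.tiGroundEnergyDensity_le_meanEnergy R hω')⟩

/-- The mean energy of a minimiser is `e₀(Ψ)`. [cite: BratteliKishimotoRobinson1978, Thm. 2 (condition 2)] -/
theorem IsMeanEnergyMinimiser.meanEnergy_eq (h : ω.IsMeanEnergyMinimiser Ψ R) :
    ω.meanEnergy Ψ R = Ψ.tiGroundEnergyDensity R :=
  le_antisymm (isMeanEnergyMinimiser_iff.1 h).2 (Ψ.tiGroundEnergyDensity_le_meanEnergy R h.1)

/-- A translation-invariant state whose mean energy is below a lower bound of all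
translation-invariant mean energies is a minimiser (the certified form: `e_Ψ(ω) ≤ c` and `c ≤ e_Ψ(ω')`
for all translation-invariant `ω'`). [cite: BratteliKishimotoRobinson1978, Thm. 2 (condition 2)] -/
theorem isMeanEnergyMinimiser_of_le_of_forall_le (hω : ω.IsTranslationInvariant) {c : ℝ}
    (hle : ω.meanEnergy Ψ R ≤ c)
    (hc : ∀ ω' : InfVolFermionState d, ω'.IsTranslationInvariant → c ≤ ω'.meanEnergy Ψ R) :
    ω.IsMeanEnergyMinimiser Ψ R :=
  ⟨hω, fun ω' hω' => hle.trans (hc ω' hω')⟩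

end InfVolFermionState

/-! ### §3. Concavity and Lipschitz continuity along a pencil -/

namespace FermionInteraction

variable (Ψ₀ Ψ₁ : FermionInteraction d) (R : ℝ)

/-- **The ground-state energy density is concave along every pencil**: `s ↦ e₀(Ψ₀ + sΨ₁)` is
concave on `ℝ` (an infimum of the affine functions `s ↦ e_{Ψ₀}(ω) + s e_{Ψ₁}(ω)`). Israel (1979)
Thm. I.3.4 (convexity of the pressure in the interaction); Koma–Tasaki (1994) §1 (the ground-state
energy is concave in the source). [cite: Israel1979, Thm. I.3.4] -/
theorem concaveOn_tiGroundEnergyDensity_pencil :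
    ConcaveOn ℝ Set.univ fun s : ℝ => (pencil Ψ₀ Ψ₁ s).tiGroundEnergyDensity R := by
  refine ⟨convex_univ, fun x _ y _ a b ha hb hab => ?_⟩
  simp only [smul_eq_mul]
  refine (pencil Ψ₀ Ψ₁ (a * x + b * y)).le_tiGroundEnergyDensity R fun ω hω => ?_
  have hx := (pencil Ψ₀ Ψ₁ x).tiGroundEnergyDensity_le_meanEnergy R hω
  have hy := (pencil Ψ₀ Ψ₁ y).tiGroundEnergyDensity_le_meanEnergy R hω
  rw [ω.meanEnergy_pencil] at hx hy ⊢
  have hsplit : ω.meanEnergy Ψ₀ R + (a * x + b * y) * ω.meanEnergy Ψ₁ R =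
      a * (ω.meanEnergy Ψ₀ R + x * ω.meanEnergy Ψ₁ R) + b * (ω.meanEnergy Ψ₀ R + y * ω.meanEnergy Ψ₁ R) := by
    linear_combination (-(ω.meanEnergy Ψ₀ R)) * hab
  rw [hsplit]
  exact add_le_add (mul_le_mul_of_nonneg_left hx ha) (mul_le_mul_of_nonneg_left hy hb)

open scoped Matrix.Norms.L2Operator in
/-- **One-sided Lipschitz step**: `e₀(Ψ₀ + sΨ₁) ≤ e₀(Ψ₀ + s'Ψ₁) + ‖E_{Ψ₁}‖·|s − s'|`.
[cite: Israel1979, Thm. I.3.4] -/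
theorem tiGroundEnergyDensity_pencil_le_add (s s' : ℝ) :
    (pencil Ψ₀ Ψ₁ s).tiGroundEnergyDensity R ≤
      (pencil Ψ₀ Ψ₁ s').tiGroundEnergyDensity R + ‖Ψ₁.meanEnergyObs R‖ * |s - s'| := by
  rw [← sub_le_iff_le_add]
  refine (pencil Ψ₀ Ψ₁ s').le_tiGroundEnergyDensity R fun ω hω => ?_
  rw [sub_le_iff_le_add]
  have h1 := (pencil Ψ₀ Ψ₁ s).tiGroundEnergyDensity_le_meanEnergy R hω
  have h2 : ω.meanEnergy (pencil Ψ₀ Ψ₁ s) R =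
      ω.meanEnergy (pencil Ψ₀ Ψ₁ s') R + (s - s') * ω.meanEnergy Ψ₁ R :=
    ω.meanEnergy_pencil_eq_add_sub_mul Ψ₀ Ψ₁ s' s R
  have h3 : (s - s') * ω.meanEnergy Ψ₁ R ≤ ‖Ψ₁.meanEnergyObs R‖ * |s - s'| := by
    calc (s - s') * ω.meanEnergy Ψ₁ R ≤ |(s - s') * ω.meanEnergy Ψ₁ R| := le_abs_self _
      _ = |s - s'| * |ω.meanEnergy Ψ₁ R| := abs_mul _ _
      _ ≤ |s - s'| * ‖Ψ₁.meanEnergyObs R‖ :=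
          mul_le_mul_of_nonneg_left (ω.abs_meanEnergy_le_norm Ψ₁ R) (abs_nonneg _)
      _ = ‖Ψ₁.meanEnergyObs R‖ * |s - s'| := mul_comm _ _
  linarith

open scoped Matrix.Norms.L2Operator in
/-- **`e₀` is `‖E_{Ψ₁}‖`-Lipschitz along the pencil**: `|e₀(Ψ₀ + sΨ₁) − e₀(Ψ₀ + s'Ψ₁)| ≤ ‖E_{Ψ₁}‖·|s − s'|`
(Israel 1979 Thm. I.3.4: `|P(Φ) − P(Ψ)| ≤ ‖Φ − Ψ‖`). [cite: Israel1979, Thm. I.3.4] -/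
theorem abs_tiGroundEnergyDensity_pencil_sub_le (s s' : ℝ) :
    |(pencil Ψ₀ Ψ₁ s).tiGroundEnergyDensity R - (pencil Ψ₀ Ψ₁ s').tiGroundEnergyDensity R| ≤
      ‖Ψ₁.meanEnergyObs R‖ * |s - s'| := by
  rw [abs_sub_le_iff]
  constructor
  · linarith [tiGroundEnergyDensity_pencil_le_add Ψ₀ Ψ₁ R s s']
  · have := tiGroundEnergyDensity_pencil_le_add Ψ₀ Ψ₁ R s' s
    rw [abs_sub_comm] at this
    linarith

end FermionInteraction

/-! ### §4. The response brackets on the conjugate density -/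

namespace InfVolFermionState

variable (ω : InfVolFermionState d) (Ψ₀ Ψ₁ : FermionInteraction d) (s R : ℝ)

/-- **Lower response bracket from a lower bound at `s + δ` and an upper bound at `s`** (every state):
if `lo ≤ e_{Ψ₀+(s+δ)Ψ₁}(ω)` and `e_{Ψ₀+sΨ₁}(ω) ≤ hi`, `δ > 0`, then `(lo − hi)/δ ≤ e_{Ψ₁}(ω)`
(`e_{s+δ} = e_s + δ e_{Ψ₁}`). Griffiths (1966) §II; Koma–Tasaki (1994) §1.
[cite: Griffiths1966, §II] -/
theorem div_le_meanEnergy_of_bounds {δ lo hi : ℝ} (hδ : 0 < δ)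
    (hlo : lo ≤ ω.meanEnergy (FermionInteraction.pencil Ψ₀ Ψ₁ (s + δ)) R)
    (hhi : ω.meanEnergy (FermionInteraction.pencil Ψ₀ Ψ₁ s) R ≤ hi) :
    (lo - hi) / δ ≤ ω.meanEnergy Ψ₁ R := by
  rw [ω.meanEnergy_pencil_eq_add_sub_mul Ψ₀ Ψ₁ s (s + δ) R, add_sub_cancel_left] at hlo
  rw [div_le_iff₀ hδ]
  linarith

/-- **Upper response bracket from a lower bound at `s − δ` and an upper bound at `s`** (every state):
if `lo ≤ e_{Ψ₀+(s−δ)Ψ₁}(ω)` and `e_{Ψ₀+sΨ₁}(ω) ≤ hi`, `δ > 0`, then `e_{Ψ₁}(ω) ≤ (hi − lo)/δ`.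
Griffiths (1966) §II; Koma–Tasaki (1994) §1. [cite: Griffiths1966, §II] -/
theorem meanEnergy_le_div_of_bounds {δ lo hi : ℝ} (hδ : 0 < δ)
    (hlo : lo ≤ ω.meanEnergy (FermionInteraction.pencil Ψ₀ Ψ₁ (s - δ)) R)
    (hhi : ω.meanEnergy (FermionInteraction.pencil Ψ₀ Ψ₁ s) R ≤ hi) :
    ω.meanEnergy Ψ₁ R ≤ (hi - lo) / δ := by
  rw [ω.meanEnergy_pencil_eq_add_sub_mul Ψ₀ Ψ₁ s (s - δ) R, sub_sub_cancel_left] at hlo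
  rw [le_div_iff₀ hδ]
  linarith

/-- **Two-sided response bracket for a translation-invariant state from three certified numbers**:
lower bounds `lo₊`, `lo₋` on the mean energy of EVERY translation-invariant state at the couplings
`s + δ`, `s − δ` (certified lower bounds on `e₀(s ± δ)`) and an upper bound `hi` on the state's own
mean energy at `s` give `(lo₊ − hi)/δ ≤ e_{Ψ₁}(ω) ≤ (hi − lo₋)/δ`. Griffiths (1966) §II–III;
Koma–Tasaki (1994) §1. [cite: Griffiths1966, §II] -/
theorem meanEnergy_mem_Icc_of_bounds (hω : ω.IsTranslationInvariant) {δ loPlus loMinus hi : ℝ}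
    (hδ : 0 < δ)
    (hloPlus : ∀ ω' : InfVolFermionState d, ω'.IsTranslationInvariant →
      loPlus ≤ ω'.meanEnergy (FermionInteraction.pencil Ψ₀ Ψ₁ (s + δ)) R)
    (hloMinus : ∀ ω' : InfVolFermionState d, ω'.IsTranslationInvariant →
      loMinus ≤ ω'.meanEnergy (FermionInteraction.pencil Ψ₀ Ψ₁ (s - δ)) R)
    (hhi : ω.meanEnergy (FermionInteraction.pencil Ψ₀ Ψ₁ s) R ≤ hi) :
    ω.meanEnergy Ψ₁ R ∈ Set.Icc ((loPlus - hi) / δ) ((hi - loMinus) / δ) :=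
  ⟨ω.div_le_meanEnergy_of_bounds Ψ₀ Ψ₁ s R hδ (hloPlus ω hω) hhi,
    ω.meanEnergy_le_div_of_bounds Ψ₀ Ψ₁ s R hδ (hloMinus ω hω) hhi⟩

variable {ω Ψ₀ Ψ₁ s R}

/-- **The supergradient inequality**: a minimiser `ω` at `s` is a trial state at every `s'`, so
`e₀(Ψ₀ + s'Ψ₁) ≤ e₀(Ψ₀ + sΨ₁) + (s' − s)·e_{Ψ₁}(ω)` — the conjugate density of any minimiser is a
supergradient of the concave `e₀` at `s`. Griffiths (1966) §II; Koma–Tasaki (1994) §1.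
[cite: Griffiths1966, §II] -/
theorem IsMeanEnergyMinimiser.tiGroundEnergyDensity_le_affine
    (h : ω.IsMeanEnergyMinimiser (FermionInteraction.pencil Ψ₀ Ψ₁ s) R) (s' : ℝ) :
    (FermionInteraction.pencil Ψ₀ Ψ₁ s').tiGroundEnergyDensity R ≤
      (FermionInteraction.pencil Ψ₀ Ψ₁ s).tiGroundEnergyDensity R + (s' - s) * ω.meanEnergy Ψ₁ R := by
  rw [← h.meanEnergy_eq, ← ω.meanEnergy_pencil_eq_add_sub_mul Ψ₀ Ψ₁ s s' R]
  exact (FermionInteraction.pencil Ψ₀ Ψ₁ s').tiGroundEnergyDensity_le_meanEnergy R h.1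

/-- **Right secant bracket for a minimiser**: `(e₀(s+δ) − e₀(s))/δ ≤ e_{Ψ₁}(ω)`, `δ > 0`.
[cite: Griffiths1966, §II] -/
theorem IsMeanEnergyMinimiser.secant_right_le_meanEnergy
    (h : ω.IsMeanEnergyMinimiser (FermionInteraction.pencil Ψ₀ Ψ₁ s) R) {δ : ℝ} (hδ : 0 < δ) :
    ((FermionInteraction.pencil Ψ₀ Ψ₁ (s + δ)).tiGroundEnergyDensity R -
        (FermionInteraction.pencil Ψ₀ Ψ₁ s).tiGroundEnergyDensity R) / δ ≤ ω.meanEnergy Ψ₁ R :=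
  ω.div_le_meanEnergy_of_bounds Ψ₀ Ψ₁ s R hδ
    ((FermionInteraction.pencil Ψ₀ Ψ₁ (s + δ)).tiGroundEnergyDensity_le_meanEnergy R h.1) h.meanEnergy_eq.le

/-- **Left secant bracket for a minimiser**: `e_{Ψ₁}(ω) ≤ (e₀(s) − e₀(s−δ))/δ`, `δ > 0`.
[cite: Griffiths1966, §II] -/
theorem IsMeanEnergyMinimiser.meanEnergy_le_secant_left
    (h : ω.IsMeanEnergyMinimiser (FermionInteraction.pencil Ψ₀ Ψ₁ s) R) {δ : ℝ} (hδ : 0 < δ) :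
    ω.meanEnergy Ψ₁ R ≤
      ((FermionInteraction.pencil Ψ₀ Ψ₁ s).tiGroundEnergyDensity R -
        (FermionInteraction.pencil Ψ₀ Ψ₁ (s - δ)).tiGroundEnergyDensity R) / δ :=
  ω.meanEnergy_le_div_of_bounds Ψ₀ Ψ₁ s R hδ
    ((FermionInteraction.pencil Ψ₀ Ψ₁ (s - δ)).tiGroundEnergyDensity_le_meanEnergy R h.1) h.meanEnergy_eq.le

/-- **Certified brackets for a minimiser**: with certified lower bounds `lo±` valid for all
translation-invariant states at `s ± δ` and a certified upper bound `hi ≥ e₀(s)` (e.g. the mean energy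
at `s` of any translation-invariant trial state), every minimiser `ω` at `s` has
`(lo₊ − hi)/δ ≤ e_{Ψ₁}(ω) ≤ (hi − lo₋)/δ`. Griffiths (1966) §II–III; Koma–Tasaki (1994) §1.
[cite: Griffiths1966, §II] -/
theorem IsMeanEnergyMinimiser.meanEnergy_mem_Icc_of_bounds
    (h : ω.IsMeanEnergyMinimiser (FermionInteraction.pencil Ψ₀ Ψ₁ s) R) {δ loPlus loMinus hi : ℝ}
    (hδ : 0 < δ)
    (hloPlus : ∀ ω' : InfVolFermionState d, ω'.IsTranslationInvariant →
      loPlus ≤ ω'.meanEnergy (FermionInteraction.pencil Ψ₀ Ψ₁ (s + δ)) R)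
    (hloMinus : ∀ ω' : InfVolFermionState d, ω'.IsTranslationInvariant →
      loMinus ≤ ω'.meanEnergy (FermionInteraction.pencil Ψ₀ Ψ₁ (s - δ)) R)
    (hhi : (FermionInteraction.pencil Ψ₀ Ψ₁ s).tiGroundEnergyDensity R ≤ hi) :
    ω.meanEnergy Ψ₁ R ∈ Set.Icc ((loPlus - hi) / δ) ((hi - loMinus) / δ) :=
  ω.meanEnergy_mem_Icc_of_bounds Ψ₀ Ψ₁ s R h.1 hδ hloPlus hloMinus (h.meanEnergy_eq.trans_le hhi)

/-- A certified upper bound on `e₀(s)` from a trial state: `e₀(Ψ₀ + sΨ₁) ≤ e_{Ψ₀+sΨ₁}(σ)` for every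
translation-invariant `σ` (restated for the hypothesis `hhi` above). [cite: BratteliKishimotoRobinson1978, Thm. 2 (condition 2)] -/
theorem tiGroundEnergyDensity_pencil_le_of_trial {σ : InfVolFermionState d} (hσ : σ.IsTranslationInvariant)
    {hi : ℝ} (hhi : σ.meanEnergy (FermionInteraction.pencil Ψ₀ Ψ₁ s) R ≤ hi) :
    (FermionInteraction.pencil Ψ₀ Ψ₁ s).tiGroundEnergyDensity R ≤ hi :=
  ((FermionInteraction.pencil Ψ₀ Ψ₁ s).tiGroundEnergyDensity_le_meanEnergy R hσ).trans hhi

/-- **The conjugate density is antitone along minimisers**: if `ω` minimises at `s`, `ω'` at `s'`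
and `s < s'`, then `e_{Ψ₁}(ω') ≤ e_{Ψ₁}(ω)` (supergradients of a concave function decrease).
Griffiths (1966) §II; Koma–Tasaki (1994) §1 (monotonicity of the order parameter in the source — here
for `H₀ + sΨ₁`; for a source `−hO` the order parameter `e_O` is NONDECREASING in `h`).
[cite: Griffiths1966, §II] -/
theorem IsMeanEnergyMinimiser.meanEnergy_antitone {ω' : InfVolFermionState d} {s' : ℝ}
    (h : ω.IsMeanEnergyMinimiser (FermionInteraction.pencil Ψ₀ Ψ₁ s) R)
    (h' : ω'.IsMeanEnergyMinimiser (FermionInteraction.pencil Ψ₀ Ψ₁ s') R) (hss' : s < s') :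
    ω'.meanEnergy Ψ₁ R ≤ ω.meanEnergy Ψ₁ R := by
  have h1 := h.tiGroundEnergyDensity_le_affine s'
  have h2 := h'.tiGroundEnergyDensity_le_affine s
  have hpos : 0 < s' - s := sub_pos.2 hss'
  nlinarith

/-- **Approximate minimisers (energy-capped states), lower bracket**: if `ω` is translation invariant
with `e_{Ψ₀+sΨ₁}(ω) ≤ e₀(s) + ε`, then `(e₀(s+δ) − e₀(s) − ε)/δ ≤ e_{Ψ₁}(ω)` for `δ > 0` — every state
inside an energy window of width `ε` above the ground-state energy density obeys the secant bracket
widened by `ε/δ`. [cite: Griffiths1966, §II] -/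
theorem div_le_meanEnergy_of_approxMinimiser (hω : ω.IsTranslationInvariant) {ε δ : ℝ} (hδ : 0 < δ)
    (hε : ω.meanEnergy (FermionInteraction.pencil Ψ₀ Ψ₁ s) R ≤
      (FermionInteraction.pencil Ψ₀ Ψ₁ s).tiGroundEnergyDensity R + ε) :
    ((FermionInteraction.pencil Ψ₀ Ψ₁ (s + δ)).tiGroundEnergyDensity R -
        (FermionInteraction.pencil Ψ₀ Ψ₁ s).tiGroundEnergyDensity R - ε) / δ ≤ ω.meanEnergy Ψ₁ R := by
  have := ω.div_le_meanEnergy_of_bounds Ψ₀ Ψ₁ s R hδ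
    ((FermionInteraction.pencil Ψ₀ Ψ₁ (s + δ)).tiGroundEnergyDensity_le_meanEnergy R hω) hε
  rwa [← sub_sub] at this

/-- **Approximate minimisers, upper bracket**: `e_{Ψ₁}(ω) ≤ (e₀(s) + ε − e₀(s−δ))/δ`.
[cite: Griffiths1966, §II] -/
theorem meanEnergy_le_div_of_approxMinimiser (hω : ω.IsTranslationInvariant) {ε δ : ℝ} (hδ : 0 < δ)
    (hε : ω.meanEnergy (FermionInteraction.pencil Ψ₀ Ψ₁ s) R ≤
      (FermionInteraction.pencil Ψ₀ Ψ₁ s).tiGroundEnergyDensity R + ε) :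
    ω.meanEnergy Ψ₁ R ≤
      ((FermionInteraction.pencil Ψ₀ Ψ₁ s).tiGroundEnergyDensity R + ε -
        (FermionInteraction.pencil Ψ₀ Ψ₁ (s - δ)).tiGroundEnergyDensity R) / δ :=
  ω.meanEnergy_le_div_of_bounds Ψ₀ Ψ₁ s R hδ
    ((FermionInteraction.pencil Ψ₀ Ψ₁ (s - δ)).tiGroundEnergyDensity_le_meanEnergy R hω) hε

end InfVolFermionState

/-! ### §5. The particle-number interaction and the `μ`-pencil of the `t–t'` Hubbard model -/

section Number

/-- **The particle-number interaction** `n`: `Φ {x} = n_{x↑} + n_{x↓}`, `Φ X = 0` for `|X| ≠ 1`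
(so `H_Λ = N_Λ`, and the pencil `Ψ − μ n` is the interaction of `H − μN`). Bratteli–Robinson II
§6.2.1 (one-body interactions); Araki–Moriya (2003) §5.1. [cite: ArakiMoriya2003, §5.1] -/
def numberInteraction (d : ℕ) : FermionInteraction d where
  Φ X := ∑ x ∈ X.attach, if X = {x.1} then (nAt x.1 x.2 0 + nAt x.1 x.2 1) else 0

/-- **On-site term**: `Φ_n {x} = n_{x↑} + n_{x↓}`. [cite: ArakiMoriya2003, §5.1] -/
theorem numberInteraction_apply_singleton (x : Site d) :
    (numberInteraction d).Φ {x} = nAt x (mem_singleton_self x) 0 + nAt x (mem_singleton_self x) 1 := by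
  simp only [numberInteraction]
  rw [Finset.sum_eq_single ⟨x, mem_singleton_self x⟩, if_pos rfl]
  · rintro ⟨b, hb⟩ - hne
    exact absurd (Subtype.ext (mem_singleton.1 hb)) hne
  · intro h
    exact absurd (mem_attach _ _) h

/-- **All other terms vanish**: `Φ_n X = 0` unless `X` is a singleton. [cite: ArakiMoriya2003, §5.1] -/
theorem numberInteraction_apply_eq_zero {X : Finset (Site d)} (h1 : ∀ x : Site d, X ≠ {x}) :
    (numberInteraction d).Φ X = 0 := by
  simp only [numberInteraction, h1, if_false, sum_const_zero]

/-- The number interaction is even. [cite: ArakiMoriya2003, §1 assumption (II)] -/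
theorem numberInteraction_isEven : (numberInteraction d).IsEven := by
  intro X
  have hn : ∀ (x : Site d) (hx : x ∈ X) (σ : Fin 2), parityAut (nAt x hx σ) = nAt x hx σ := by
    intro x hx σ
    rw [nAt, numberOp, map_mul, parityAut_creation, parityAut_annihilation, neg_mul_neg]
  simp only [numberInteraction, map_sum, apply_ite parityAut, map_zero, map_add, hn]

/-- The number interaction is Hermitian. [cite: ArakiMoriya2003, §1 assumption (II)] -/
theorem numberInteraction_isHermitian : (numberInteraction d).IsHermitian := by
  intro X
  have hn : ∀ (x : Site d) (hx : x ∈ X) (σ : Fin 2), (nAt x hx σ)ᴴ = nAt x hx σ := by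
    intro x hx σ
    rw [nAt, ← numberAt_orb, (numberAt_isHermitian _).eq]
  unfold Matrix.IsHermitian
  simp only [numberInteraction, Matrix.conjTranspose_sum, apply_ite Matrix.conjTranspose,
    Matrix.conjTranspose_zero, Matrix.conjTranspose_add, hn]

/-- The number interaction has range `0` (hence every range `R`): only singletons carry terms.
[cite: ArakiMoriya2003, §5.4] -/
theorem numberInteraction_hasFiniteRange (R : ℝ) (hR : 0 ≤ R) : (numberInteraction d).HasFiniteRange R := by
  intro X hX
  refine numberInteraction_apply_eq_zero fun x hx => ?_
  rw [hx, coe_singleton, Metric.diam_singleton] at hX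
  exact absurd hX (not_lt.2 hR)

/-- **The mean-energy observable of the number interaction is `n_{0↑} + n_{0↓}`** (embedded in
`𝔄_{thicken {0} R}`): the only `X ∋ 0` carrying a term is `{0}`.
[cite: BratteliKishimotoRobinson1978, §3 (mean energy functional)] -/
theorem numberInteraction_meanEnergyObs (R : ℝ) :
    (numberInteraction d).meanEnergyObs R =
      fermionEmbed (PolySite.incl (singleton_subset_iff.2 (zero_mem_thicken_zero R)))
        ((numberInteraction d).Φ {0}) := by
  classical
  set T : Finset (Site d) := thicken ({0} : Finset (Site d)) R with hT
  set F : Finset (Site d) → FermionOp T := fun X =>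
    if h : X ⊆ T then ((X.card : ℂ)⁻¹) • fermionEmbed (PolySite.incl h) ((numberInteraction d).Φ X)
    else 0 with hF
  rw [FermionInteraction.meanEnergyObs_eq_sum]
  change ∑ X ∈ T.powerset with (0 : Site d) ∈ X, F X = _
  have h0T : ({0} : Finset (Site d)) ⊆ T := singleton_subset_iff.2 (zero_mem_thicken_zero R)
  have hmem : ({0} : Finset (Site d)) ∈ T.powerset.filter (fun X => (0 : Site d) ∈ X) :=
    mem_filter.2 ⟨mem_powerset.2 h0T, mem_singleton_self (0 : Site d)⟩
  rw [Finset.sum_eq_single ({0} : Finset (Site d))]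
  · simp only [hF]
    rw [dif_pos h0T, card_singleton, Nat.cast_one, inv_one, one_smul]
  · intro X hX hne
    have hΦ : (numberInteraction d).Φ X = 0 := by
      refine numberInteraction_apply_eq_zero fun x hx => hne ?_
      have h0 := (mem_filter.1 hX).2
      rw [hx, mem_singleton] at h0
      rw [hx, h0]
    simp only [hF, hΦ, map_zero, smul_zero, dite_eq_ite, ite_self]
  · exact fun h => absurd hmem h

namespace InfVolFermionState

/-- **The mean energy of the number interaction is the density**: `e_n(ω) = ρ(ω) = Re ω(n_{0↑} + n_{0↓})`
for every state `ω` and every range parameter `R`. [cite: ArakiMoriya2003, §4.1] -/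
theorem meanEnergy_numberInteraction (ω : InfVolFermionState d) (R : ℝ) :
    ω.meanEnergy (numberInteraction d) R = ω.density := by
  rw [InfVolFermionState.meanEnergy, numberInteraction_meanEnergyObs, ω.compatible,
    numberInteraction_apply_singleton, density, densityAt]

end InfVolFermionState

end Number

section TTPrimeMu

/-- **The `μ`-pencil of the `t–t'` Hubbard model**, `Φ(t,t',U) − μ·n`: the interaction whose local
Hamiltonians are `H^{tt'}_Λ − μ N_Λ` (termwise `Φ X = Φ^{tt'U} X + (−μ) Φ_n X`, i.e. the pencil
`pencil Φ(t,t',U) n (−μ)`, `hubbardTTPrimeMuInteraction_apply`). Bratteli–Robinson II §6.2.1;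
Xu et al. (2024) eq. (1) for `Φ(t,t',U)`. [cite: XuEtAl2024, eq. (1)] -/
def hubbardTTPrimeMuInteraction (t t' U μ : ℝ) : FermionInteraction 2 :=
  FermionInteraction.pencil (hubbardTTPrimeFermionInteraction t t' U) (numberInteraction 2) (-μ)

variable (t t' U μ : ℝ)

/-- The terms of the `μ`-pencil (definitional). [cite: XuEtAl2024, eq. (1)] -/
theorem hubbardTTPrimeMuInteraction_apply (X : Finset (Site 2)) :
    (hubbardTTPrimeMuInteraction t t' U μ).Φ X =
      (hubbardTTPrimeFermionInteraction t t' U).Φ X + ((-μ : ℝ) : ℂ) • (numberInteraction 2).Φ X := rfl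

/-- The `μ`-pencil is even. [cite: ArakiMoriya2003, §1 assumption (II)] -/
theorem hubbardTTPrimeMuInteraction_isEven : (hubbardTTPrimeMuInteraction t t' U μ).IsEven :=
  FermionInteraction.isEven_pencil (hubbardTTPrimeFermionInteraction_isEven t t' U) numberInteraction_isEven _

/-- The `μ`-pencil is Hermitian. [cite: ArakiMoriya2003, §1 assumption (II)] -/
theorem hubbardTTPrimeMuInteraction_isHermitian : (hubbardTTPrimeMuInteraction t t' U μ).IsHermitian :=
  FermionInteraction.isHermitian_pencil (hubbardTTPrimeFermionInteraction_isHermitian t t' U)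
    numberInteraction_isHermitian _

/-- **The local Hamiltonians of the `μ`-pencil**: `H^{μ}_Λ = H^{tt'}_Λ + (−μ)·N^{Φ_n}_Λ`.
[cite: BratteliRobinsonII1997, §6.2.1] -/
theorem hubbardTTPrimeMuInteraction_localHamiltonian (Λ : Finset (Site 2)) :
    (hubbardTTPrimeMuInteraction t t' U μ).localHamiltonian Λ =
      (hubbardTTPrimeFermionInteraction t t' U).localHamiltonian Λ +
        ((-μ : ℝ) : ℂ) • (numberInteraction 2).localHamiltonian Λ :=
  FermionInteraction.localHamiltonian_pencil _ _ _ Λ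

namespace InfVolFermionState

/-- **The mean energy of the `μ`-pencil is `e^{tt'}(ω) − μ ρ(ω)`** for every state `ω`.
[cite: BratteliKishimotoRobinson1978, §3 (mean energy functional)] -/
theorem meanEnergy_hubbardTTPrimeMu (ω : InfVolFermionState 2) :
    ω.meanEnergy (hubbardTTPrimeMuInteraction t t' U μ) 1 =
      ω.meanEnergy (hubbardTTPrimeFermionInteraction t t' U) 1 - μ * ω.density := by
  rw [hubbardTTPrimeMuInteraction, meanEnergy_pencil, meanEnergy_numberInteraction]
  ring

variable {t t' U μ}
variable {ω : InfVolFermionState 2}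
variable (hgs : ∀ (Λ : Finset (Site 2)) (A : FermionOp Λ),
    0 ≤ (ω.expect (thicken Λ 1)
      ((fermionEmbed (PolySite.incl (subset_thicken Λ 1)) A)ᴴ *
        (((hubbardTTPrimeFermionInteraction t t' U).localHamiltonian (thicken Λ 1) -
              (μ : ℂ) • (totalNumber : FermionOp (thicken Λ 1))) *
            fermionEmbed (PolySite.incl (subset_thicken Λ 1)) A -
          fermionEmbed (PolySite.incl (subset_thicken Λ 1)) A *
            ((hubbardTTPrimeFermionInteraction t t' U).localHamiltonian (thicken Λ 1) -
              (μ : ℂ) • (totalNumber : FermionOp (thicken Λ 1)))))).re)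

include hgs in
/-- **Translation-invariant ground states of `H(t,t',U) − μN` minimise the `μ`-pencil**: if `ω` is
translation invariant and satisfies the Bratteli–Robinson ground-state condition for the dynamics of
`H(t,t',U) − μN` on every thickened region (hypothesis `hgs`, as in
`FermionGroundStatesMinimiseMeanEnergy.lean`), then `ω` is a mean-energy minimiser of
`hubbardTTPrimeMuInteraction t t' U μ` (Bratteli–Kishimoto–Robinson 1978 Thm. 2, `1 ⇒ 2`, for the
`t–t'` Hubbard model with chemical potential; the tree's `meanEnergy_sub_mul_density_le_of_groundState`
repackaged). [cite: BratteliKishimotoRobinson1978, Thm. 2 (p. 47)] -/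
theorem isMeanEnergyMinimiser_hubbardTTPrimeMu_of_groundState (hω : ω.IsTranslationInvariant) :
    ω.IsMeanEnergyMinimiser (hubbardTTPrimeMuInteraction t t' U μ) 1 := by
  refine ⟨hω, fun σ hσ => ?_⟩
  rw [meanEnergy_hubbardTTPrimeMu, meanEnergy_hubbardTTPrimeMu]
  exact meanEnergy_sub_mul_density_le_of_groundState hgs hω hσ

include hgs in
/-- **The grand-canonical energy density at `μ` is attained by every such ground state**:
`e^{tt'}(ω) − μ ρ(ω) = e_GC(μ) := tiGroundEnergyDensity (Φ(t,t',U) − μn) 1`.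
[cite: BratteliKishimotoRobinson1978, Thm. 2 (p. 47)] -/
theorem meanEnergy_sub_mul_density_eq_tiGroundEnergyDensity_of_groundState (hω : ω.IsTranslationInvariant) :
    ω.meanEnergy (hubbardTTPrimeFermionInteraction t t' U) 1 - μ * ω.density =
      (hubbardTTPrimeMuInteraction t t' U μ).tiGroundEnergyDensity 1 := by
  rw [← meanEnergy_hubbardTTPrimeMu]
  exact (isMeanEnergyMinimiser_hubbardTTPrimeMu_of_groundState hgs hω).meanEnergy_eq

include hgs in
/-- **The density of a translation-invariant ground state of `H(t,t',U) − μN` lies in the `μ`-secant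
brackets of the grand-canonical energy density** `e_GC(·) = tiGroundEnergyDensity (Φ(t,t',U) − (·)n) 1`
(concave in `μ`): for every `δ > 0`,
`(e_GC(μ) − e_GC(μ+δ))/δ ≤ ρ(ω) ≤ (e_GC(μ−δ) − e_GC(μ))/δ` — the thermodynamic-limit
`ρ(μ) = −∂e_GC/∂μ` read through finite differences (Griffiths 1966 §II; Lieb–Wu 2003 §7 for the
Hubbard chemical potentials). [cite: Griffiths1966, §II] -/
theorem density_mem_secant_brackets_of_groundState (hω : ω.IsTranslationInvariant) {δ : ℝ} (hδ : 0 < δ) :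
    ((hubbardTTPrimeMuInteraction t t' U (μ - δ)).tiGroundEnergyDensity 1 -
          (hubbardTTPrimeMuInteraction t t' U μ).tiGroundEnergyDensity 1) / δ ≤ ω.density ∧
      ω.density ≤
        ((hubbardTTPrimeMuInteraction t t' U μ).tiGroundEnergyDensity 1 -
          (hubbardTTPrimeMuInteraction t t' U (μ + δ)).tiGroundEnergyDensity 1) / δ := by
  have hmin := isMeanEnergyMinimiser_hubbardTTPrimeMu_of_groundState hgs hω
  unfold hubbardTTPrimeMuInteraction at hmin ⊢
  -- the pencil parameter is `s = -μ`: `s + δ = -(μ - δ)`, `s - δ = -(μ + δ)`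
  have h1 := hmin.secant_right_le_meanEnergy hδ
  have h2 := hmin.meanEnergy_le_secant_left hδ
  rw [meanEnergy_numberInteraction] at h1 h2
  rw [show -μ + δ = -(μ - δ) by ring] at h1
  rw [show -μ - δ = -(μ + δ) by ring] at h2
  exact ⟨h1, h2⟩

include hgs in
/-- **Certified form.** If `lo₊ ≤ e_{Φ−(μ+δ)n}(ω')` and `lo₋ ≤ e_{Φ−(μ−δ)n}(ω')` for every
translation-invariant `ω'` (certified grand-canonical energy lower bounds at `μ + δ` and `μ − δ`) and
`e_GC(μ) ≤ hi` (a certified upper bound, e.g. `e^{tt'}(σ) − μρ(σ)` of any translation-invariant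
trial state `σ`, `tiGroundEnergyDensity_pencil_le_of_trial`), then every translation-invariant ground
state `ω` of `H(t,t',U) − μN` has `(lo₋ − hi)/δ ≤ ρ(ω) ≤ (hi − lo₊)/δ`. [cite: Griffiths1966, §II] -/
theorem density_mem_Icc_of_groundState_of_bounds (hω : ω.IsTranslationInvariant)
    {δ loPlus loMinus hi : ℝ} (hδ : 0 < δ)
    (hloPlus : ∀ ω' : InfVolFermionState 2, ω'.IsTranslationInvariant →
      loPlus ≤ ω'.meanEnergy (hubbardTTPrimeMuInteraction t t' U (μ + δ)) 1)
    (hloMinus : ∀ ω' : InfVolFermionState 2, ω'.IsTranslationInvariant →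
      loMinus ≤ ω'.meanEnergy (hubbardTTPrimeMuInteraction t t' U (μ - δ)) 1)
    (hhi : (hubbardTTPrimeMuInteraction t t' U μ).tiGroundEnergyDensity 1 ≤ hi) :
    ω.density ∈ Set.Icc ((loMinus - hi) / δ) ((hi - loPlus) / δ) := by
  have hmin := isMeanEnergyMinimiser_hubbardTTPrimeMu_of_groundState hgs hω
  unfold hubbardTTPrimeMuInteraction at hmin hloPlus hloMinus hhi
  rw [show -(μ + δ) = -μ - δ by ring] at hloPlus
  rw [show -(μ - δ) = -μ + δ by ring] at hloMinus
  have h := hmin.meanEnergy_mem_Icc_of_bounds hδ hloMinus hloPlus hhi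
  rwa [meanEnergy_numberInteraction] at h

end InfVolFermionState

end TTPrimeMu

/-! ### §6. The singlet pair-source interaction (Koma–Tasaki's symmetry-breaking pair field) -/

section PairSource

/-- The singlet pair annihilator on an ordered pair of sites of a region:
`b_{x,y} = c_{x↑} c_{y↓} − c_{x↓} c_{y↑}` (for `y = x + e` the tree's torus `singletBond`, for `x = y`
twice the on-site pair `c_{x↑}c_{x↓}`). Scalapino, Phys. Rep. 250 (1995) §2 eq. (2.2); Koma–Tasaki
(1994) §1. [cite: KomaTasaki1994, §1] -/
abbrev singletPairAt {X : Finset (Site d)} (x y : Site d) (hx : x ∈ X) (hy : y ∈ X) : FermionOp X :=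
  cAt x hx 0 * cAt y hy 1 - cAt x hx 1 * cAt y hy 0

/-- The singlet pair annihilator carries charge `−2` but is a product of two field operators, hence
EVEN under the parity automorphism `Θ`. [cite: ArakiMoriya2003, §1 assumption (II)] -/
theorem parityAut_singletPairAt {X : Finset (Site d)} (x y : Site d) (hx : x ∈ X) (hy : y ∈ X) :
    parityAut (singletPairAt x y hx hy) = singletPairAt x y hx hy := by
  rw [singletPairAt, map_sub, map_mul, map_mul, cAt, cAt, cAt, cAt, parityAut_annihilation,
    parityAut_annihilation, parityAut_annihilation, parityAut_annihilation, neg_mul_neg, neg_mul_neg]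

/-- **The singlet pair-source interaction on `ℤ²`** with (even) form factor `g : ℤ² → ℝ` on the steps
`{0, ±e₁, ±e₂}`: the ORDER OPERATOR `O = Δ_g + Δ_g†` of Koma–Tasaki written as a range-`1`
interaction — `Φ {x} = (g(0)/√2)(b_{x,x} + b_{x,x}†)`,
`Φ {x, x + e_i} = √2·g(e_i)·(b_{x,x+e_i} + b_{x,x+e_i}†)` (the bond `{x, x+e_i}` collects the two
oriented terms `(x, e_i)` and `(x + e_i, −e_i)` of `Δ_g = Σ_x Σ_e (g(e)/√2) b_{x,x+e}`, equal for even `g`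
by the symmetry `b_{y,x} = b_{x,y}` of the singlet), `Φ X = 0` otherwise. The Koma–Tasaki sourced
Hamiltonian `H − μN − h(Δ + Δ†)` is then the pencil with coefficient `−h` (§7); for
`g = dWaveFormFactor` (`g(0) = 0`, `g(±e₁) = 1`, `g(±e₂) = −1`) this is the `d_{x²−y²}` pair source of
`DWaveSource.lean` / `DWaveSourceWindowHamiltonian.lean` (there on tori / windows at `t' = 0`).
[cite: KomaTasaki1994, §1] -/
def pairSourceInteraction (g : Site 2 → ℝ) : FermionInteraction 2 where
  Φ X :=
    (∑ x ∈ X.attach, if X = {x.1} then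
        ((g 0 / Real.sqrt 2 : ℝ) : ℂ) •
          (singletPairAt x.1 x.1 x.2 x.2 + (singletPairAt x.1 x.1 x.2 x.2)ᴴ) else 0) +
      ∑ x ∈ X.attach, ∑ y ∈ X.attach,
        if (∃ i : Fin 2, y.1 = x.1 + unitVec i) ∧ X = {x.1, y.1} then
          ((Real.sqrt 2 * g (y.1 - x.1) : ℝ) : ℂ) •
            (singletPairAt x.1 y.1 x.2 y.2 + (singletPairAt x.1 y.1 x.2 y.2)ᴴ)
        else 0

variable (g : Site 2 → ℝ)

/-- **On-site term**: `Φ {x} = (g 0/√2)(b_{x,x} + b_{x,x}†)`. [cite: KomaTasaki1994, §1] -/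
theorem pairSourceInteraction_apply_singleton (x : Site 2) :
    (pairSourceInteraction g).Φ {x} =
      ((g 0 / Real.sqrt 2 : ℝ) : ℂ) •
        (singletPairAt x x (mem_singleton_self x) (mem_singleton_self x) +
          (singletPairAt x x (mem_singleton_self x) (mem_singleton_self x))ᴴ) := by
  have hB : ∀ a b : Site 2, ¬ ((∃ i : Fin 2, b = a + unitVec i) ∧ ({x} : Finset (Site 2)) = {a, b}) := by
    rintro a b ⟨⟨i, rfl⟩, h⟩
    have ha : a ∈ ({x} : Finset (Site 2)) := h ▸ mem_insert_self _ _
    have hb : a + unitVec i ∈ ({x} : Finset (Site 2)) := h ▸ mem_insert_of_mem (mem_singleton_self _)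
    rw [mem_singleton] at ha hb
    exact self_ne_add_unitVec a i (ha.trans hb.symm)
  simp only [pairSourceInteraction, hB, if_false, sum_const_zero, add_zero]
  rw [Finset.sum_eq_single ⟨x, mem_singleton_self x⟩, if_pos rfl]
  · rintro ⟨b, hb⟩ - hne
    exact absurd (Subtype.ext (mem_singleton.1 hb)) hne
  · intro h
    exact absurd (mem_attach _ _) h

/-- **Bond term**: `Φ {x, x + e_i} = √2 g(e_i) (b_{x,x+e_i} + b_{x,x+e_i}†)`. [cite: KomaTasaki1994, §1] -/
theorem pairSourceInteraction_apply_pair (x : Site 2) (i : Fin 2) :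
    (pairSourceInteraction g).Φ {x, x + unitVec i} =
      ((Real.sqrt 2 * g (unitVec i) : ℝ) : ℂ) •
        (singletPairAt x (x + unitVec i) (mem_insert_self _ _) (mem_insert_of_mem (mem_singleton_self _)) +
          (singletPairAt x (x + unitVec i) (mem_insert_self _ _)
            (mem_insert_of_mem (mem_singleton_self _)))ᴴ) := by
  have hxy : x ≠ x + unitVec i := self_ne_add_unitVec x i
  have hcard : ({x, x + unitVec i} : Finset (Site 2)).card = 2 := card_pair hxy
  have hA : ∀ a : Site 2, ¬ (({x, x + unitVec i} : Finset (Site 2)) = {a}) := fun a h => by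
    have := congrArg Finset.card h
    rw [hcard, card_singleton] at this
    exact absurd this (by norm_num)
  simp only [pairSourceInteraction, hA, if_false, sum_const_zero, zero_add]
  have hmem : ∀ {a : Site 2}, a ∈ ({x, x + unitVec i} : Finset (Site 2)) ↔ a = x ∨ a = x + unitVec i :=
    fun {a} => by rw [mem_insert, mem_singleton]
  rw [Finset.sum_eq_single ⟨x, mem_insert_self _ _⟩]
  · rw [Finset.sum_eq_single ⟨x + unitVec i, mem_insert_of_mem (mem_singleton_self _)⟩,
      if_pos ⟨⟨i, rfl⟩, rfl⟩, add_sub_cancel_left]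
    · rintro ⟨b, hb⟩ - hne
      refine if_neg ?_
      rintro ⟨⟨j, hj⟩, -⟩
      rcases hmem.1 hb with rfl | rfl
      · exact self_ne_add_unitVec _ j hj
      · exact hne rfl
    · intro h
      exact absurd (mem_attach _ _) h
  · rintro ⟨a, ha⟩ - hne
    refine Finset.sum_eq_zero fun b _ => if_neg ?_
    rintro ⟨⟨j, hj⟩, -⟩
    rcases hmem.1 ha with rfl | rfl
    · exact hne rfl
    · rcases hmem.1 b.2 with hb | hb
      · exact add_unitVec_add_unitVec_ne_self _ i j (hj.symm.trans hb)
      · exact self_ne_add_unitVec _ j (hb.symm.trans hj)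
  · intro h
    exact absurd (mem_attach _ _) h

/-- **All other terms vanish.** [cite: KomaTasaki1994, §1] -/
theorem pairSourceInteraction_apply_eq_zero {X : Finset (Site 2)} (h1 : ∀ x : Site 2, X ≠ {x})
    (h2 : ∀ (x : Site 2) (i : Fin 2), X ≠ {x, x + unitVec i}) :
    (pairSourceInteraction g).Φ X = 0 := by
  have hB : ∀ a b : Site 2, ¬ ((∃ i : Fin 2, b = a + unitVec i) ∧ X = {a, b}) := by
    rintro a b ⟨⟨i, rfl⟩, h⟩
    exact h2 a i h
  simp only [pairSourceInteraction, h1, hB, if_false, sum_const_zero, add_zero]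

/-- **The pair-source interaction is even** (every term is a sum of products of two field operators).
[cite: ArakiMoriya2003, §1 assumption (II)] -/
theorem pairSourceInteraction_isEven : (pairSourceInteraction g).IsEven := by
  intro X
  have hP : ∀ (x y : Site 2) (hx : x ∈ X) (hy : y ∈ X),
      parityAut (singletPairAt x y hx hy + (singletPairAt x y hx hy)ᴴ) =
        singletPairAt x y hx hy + (singletPairAt x y hx hy)ᴴ := by
    intro x y hx hy
    rw [map_add, parityAut_conjTranspose, parityAut_singletPairAt]
  simp only [pairSourceInteraction, map_add, map_sum, apply_ite parityAut, map_zero, map_smul, hP]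

/-- **The pair-source interaction is Hermitian** (each term is `c • (B + Bᴴ)` with `c` real).
[cite: ArakiMoriya2003, §1 assumption (II)] -/
theorem pairSourceInteraction_isHermitian : (pairSourceInteraction g).IsHermitian := by
  intro X
  have hP : ∀ (x y : Site 2) (hx : x ∈ X) (hy : y ∈ X),
      (singletPairAt x y hx hy + (singletPairAt x y hx hy)ᴴ)ᴴ =
        singletPairAt x y hx hy + (singletPairAt x y hx hy)ᴴ := by
    intro x y hx hy
    rw [Matrix.conjTranspose_add, Matrix.conjTranspose_conjTranspose, add_comm]
  unfold Matrix.IsHermitian pairSourceInteraction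
  simp only [Matrix.conjTranspose_add, Matrix.conjTranspose_sum, apply_ite Matrix.conjTranspose,
    Matrix.conjTranspose_zero, Matrix.conjTranspose_smul, hP, Complex.star_def, Complex.conj_ofReal]

/-- **The mean-energy observable of the pair-source interaction** (range `1`): in `𝔄_{[-1,1]²}`,
`E_Φ = Γ(Φ{0}) + Σ_i (½ Γ(Φ{0, e_i}) + ½ Γ(Φ{−e_i, 0}))` — the on-site pair at the origin plus one half
of each of the four bonds through the origin. [cite: BratteliKishimotoRobinson1978, §3 (mean energy functional)] -/
theorem pairSourceInteraction_meanEnergyObs :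
    (pairSourceInteraction g).meanEnergyObs 1 =
      fermionEmbed (PolySite.incl (singleton_subset_iff.2 (zero_mem_thicken_zero 1)))
          ((pairSourceInteraction g).Φ {0}) +
        ∑ i : Fin 2,
          ((2 : ℂ)⁻¹ • fermionEmbed (PolySite.incl (pair_unitVec_subset_thicken_one i))
              ((pairSourceInteraction g).Φ {0, 0 + unitVec i}) +
            (2 : ℂ)⁻¹ • fermionEmbed (PolySite.incl (pair_neg_unitVec_subset_thicken_one i))
              ((pairSourceInteraction g).Φ {-unitVec i, -unitVec i + unitVec i})) := by
  classical
  set T : Finset (Site 2) := thicken ({0} : Finset (Site 2)) 1 with hT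
  set F : Finset (Site 2) → FermionOp T := fun X =>
    if h : X ⊆ T then ((X.card : ℂ)⁻¹) • fermionEmbed (PolySite.incl h) ((pairSourceInteraction g).Φ X)
    else 0 with hF
  rw [FermionInteraction.meanEnergyObs_eq_sum]
  change ∑ X ∈ T.powerset with (0 : Site 2) ∈ X, F X = _
  -- the support: `{0}`, `{0, e_i}`, `{-e_i, 0}`
  set S' : Finset (Finset (Site 2)) :=
    insert {0} ((univ.image fun i : Fin 2 => ({0, 0 + unitVec i} : Finset (Site 2))) ∪
      univ.image fun i : Fin 2 => ({-unitVec i, -unitVec i + unitVec i} : Finset (Site 2))) with hS'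
  have hS'sub : S' ⊆ T.powerset.filter fun X => (0 : Site 2) ∈ X := by
    intro X hX
    rw [hS', mem_insert, mem_union, mem_image, mem_image] at hX
    rw [mem_filter, mem_powerset]
    rcases hX with rfl | ⟨i, -, rfl⟩ | ⟨i, -, rfl⟩
    · exact ⟨singleton_subset_iff.2 (zero_mem_thicken_zero 1), mem_singleton_self _⟩
    · exact ⟨pair_unitVec_subset_thicken_one i, mem_insert_self _ _⟩
    · refine ⟨pair_neg_unitVec_subset_thicken_one i, ?_⟩
      rw [neg_add_cancel]
      exact mem_insert_of_mem (mem_singleton_self _)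
  have hzero : ∀ X ∈ T.powerset.filter (fun X => (0 : Site 2) ∈ X), X ∉ S' → F X = 0 := by
    intro X hX hXS
    rw [mem_filter, mem_powerset] at hX
    have hΦ : (pairSourceInteraction g).Φ X = 0 := by
      refine pairSourceInteraction_apply_eq_zero g (fun x hx => hXS ?_) (fun x i hx => hXS ?_)
      · have : x = 0 := by
          have h0 := hX.2; rw [hx, mem_singleton] at h0; exact h0.symm
        subst this
        rw [hS', hx]
        exact mem_insert_self _ _
      · have h0 := hX.2
        rw [hx, mem_insert, mem_singleton] at h0
        rw [hS', hx, mem_insert, mem_union, mem_image, mem_image]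
        rcases h0 with h0 | h0
        · exact Or.inr (Or.inl ⟨i, mem_univ _, by rw [← h0, zero_add]⟩)
        · refine Or.inr (Or.inr ⟨i, mem_univ _, ?_⟩)
          have : x = -unitVec i := eq_neg_of_add_eq_zero_left h0.symm
          rw [this]
    simp only [hF, hΦ, map_zero, smul_zero, dite_eq_ite, ite_self]
  rw [← Finset.sum_subset hS'sub hzero]
  -- split the sum over `S'`
  have hnot0 : ({0} : Finset (Site 2)) ∉
      (univ.image fun i : Fin 2 => ({0, 0 + unitVec i} : Finset (Site 2))) ∪
        univ.image fun i : Fin 2 => ({-unitVec i, -unitVec i + unitVec i} : Finset (Site 2)) := by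
    rw [mem_union, mem_image, mem_image]
    rintro (⟨i, -, h⟩ | ⟨i, -, h⟩)
    · have := congrArg Finset.card h
      rw [card_pair (self_ne_add_unitVec 0 i), card_singleton] at this
      exact absurd this (by norm_num)
    · have := congrArg Finset.card h
      rw [card_pair (self_ne_add_unitVec _ i), card_singleton] at this
      exact absurd this (by norm_num)
  have hdisj : Disjoint (univ.image fun i : Fin 2 => ({0, 0 + unitVec i} : Finset (Site 2)))
      (univ.image fun i : Fin 2 => ({-unitVec i, -unitVec i + unitVec i} : Finset (Site 2))) := by
    rw [disjoint_iff_ne]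
    rintro X hX Y hY rfl
    rw [mem_image] at hX hY
    obtain ⟨i, -, rfl⟩ := hX
    obtain ⟨j, -, hj⟩ := hY
    have hmem : -unitVec j ∈ ({0, 0 + unitVec i} : Finset (Site 2)) := hj ▸ mem_insert_self _ _
    rw [mem_insert, mem_singleton, zero_add, neg_eq_zero] at hmem
    rcases hmem with h | h
    · exact uvec_ne_zero j h
    · exact uvec_add_uvec_ne_zero j i (show unitVec j + unitVec i = 0 by rw [← h, add_neg_cancel])
  have hinj1 : Set.InjOn (fun i : Fin 2 => ({0, 0 + unitVec i} : Finset (Site 2))) ↑(univ : Finset (Fin 2)) := by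
    intro i _ j _ h
    dsimp only at h
    have hmem : 0 + unitVec i ∈ ({0, 0 + unitVec j} : Finset (Site 2)) := h ▸ mem_insert_of_mem (mem_singleton_self _)
    rw [mem_insert, mem_singleton, zero_add, zero_add] at hmem
    rcases hmem with h' | h'
    · exact absurd h' (uvec_ne_zero i)
    · exact uvec_injective h'
  have hinj2 : Set.InjOn (fun i : Fin 2 => ({-unitVec i, -unitVec i + unitVec i} : Finset (Site 2)))
      ↑(univ : Finset (Fin 2)) := by
    intro i _ j _ h
    dsimp only at h
    have hmem : -unitVec i ∈ ({-unitVec j, -unitVec j + unitVec j} : Finset (Site 2)) := by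
      have : -unitVec i ∈ ({-unitVec i, -unitVec i + unitVec i} : Finset (Site 2)) := mem_insert_self _ _
      rwa [h] at this
    rw [mem_insert, mem_singleton, neg_add_cancel, neg_inj, neg_eq_zero] at hmem
    rcases hmem with h' | h'
    · exact uvec_injective h'
    · exact absurd h' (uvec_ne_zero i)
  rw [hS', Finset.sum_insert hnot0, Finset.sum_union hdisj, Finset.sum_image hinj1, Finset.sum_image hinj2,
    ← Finset.sum_add_distrib]
  -- evaluate `F` on the three kinds of sets
  have h0T : ({0} : Finset (Site 2)) ⊆ T := singleton_subset_iff.2 (zero_mem_thicken_zero 1)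
  have h1T : ∀ i : Fin 2, ({0, 0 + unitVec i} : Finset (Site 2)) ⊆ T := fun i =>
    pair_unitVec_subset_thicken_one i
  have h2T : ∀ i : Fin 2, ({-unitVec i, -unitVec i + unitVec i} : Finset (Site 2)) ⊆ T := fun i =>
    pair_neg_unitVec_subset_thicken_one i
  have hF0 : F {0} = fermionEmbed (PolySite.incl h0T) ((pairSourceInteraction g).Φ {0}) := by
    simp only [hF]
    rw [dif_pos h0T, card_singleton, Nat.cast_one, inv_one, one_smul]
  have hF1 : ∀ i : Fin 2, F {0, 0 + unitVec i} =
      (2 : ℂ)⁻¹ • fermionEmbed (PolySite.incl (h1T i)) ((pairSourceInteraction g).Φ {0, 0 + unitVec i}) := by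
    intro i
    simp only [hF]
    rw [dif_pos (h1T i), card_pair (self_ne_add_unitVec (0 : Site 2) i), Nat.cast_ofNat]
  have hF2 : ∀ i : Fin 2, F {-unitVec i, -unitVec i + unitVec i} =
      (2 : ℂ)⁻¹ • fermionEmbed (PolySite.incl (h2T i))
        ((pairSourceInteraction g).Φ {-unitVec i, -unitVec i + unitVec i}) := by
    intro i
    simp only [hF]
    rw [dif_pos (h2T i), card_pair (self_ne_add_unitVec (-unitVec i : Site 2) i), Nat.cast_ofNat]
  rw [hF0]
  congr 1
  exact Finset.sum_congr rfl fun i _ => by rw [hF1, hF2]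

namespace InfVolFermionState

/-- **The pair-source energy density of a state** in closed form: for every state `ω`,
`e_P(ω) = Re ω(Φ{0}) + ½ Σ_i (Re ω(Φ{0,e_i}) + Re ω(Φ{−e_i,0}))` with the on-site / bond terms of
`pairSourceInteraction_apply_singleton` / `_apply_pair` — the density of the order operator
`O = Δ_g + Δ_g†` (`½` of each bond through the origin: every bond is shared by two sites). For a
translation-invariant `ω` this is `lim_Λ ω(O_Λ)/|Λ|`, Koma–Tasaki's order-parameter density at the
source in force. [cite: KomaTasaki1994, §1] -/
theorem meanEnergy_pairSourceInteraction_eq (ω : InfVolFermionState 2) :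
    ω.meanEnergy (pairSourceInteraction g) 1 =
      (ω.expect {0} ((pairSourceInteraction g).Φ {0})).re +
        ∑ i : Fin 2, (2⁻¹ * (ω.expect {0, 0 + unitVec i} ((pairSourceInteraction g).Φ {0, 0 + unitVec i})).re +
          2⁻¹ * (ω.expect {-unitVec i, -unitVec i + unitVec i}
            ((pairSourceInteraction g).Φ {-unitVec i, -unitVec i + unitVec i})).re) := by
  rw [InfVolFermionState.meanEnergy, pairSourceInteraction_meanEnergyObs, map_add, map_sum, Complex.add_re,
    ω.compatible, Complex.re_sum]
  congr 1
  refine Finset.sum_congr rfl fun i _ => ?_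
  rw [map_add, map_smul, map_smul, ω.compatible, ω.compatible, Complex.add_re, smul_eq_mul, smul_eq_mul,
    Complex.mul_re, Complex.mul_re]
  have h2 : ((2 : ℂ)⁻¹).re = 2⁻¹ := by norm_num
  have h2' : ((2 : ℂ)⁻¹).im = 0 := by norm_num
  rw [h2, h2', zero_mul, sub_zero, zero_mul, sub_zero]

end InfVolFermionState

end PairSource

/-! ### §7. The pair-sourced `t–t'` Hubbard model `H(t,t',U) − μN − h(Δ_g + Δ_g†)` and the brackets on
the induced pair amplitude -/

section Sourced

/-- **The pair-sourced grand-canonical `t–t'` Hubbard interaction** (Koma–Tasaki's symmetry-breaking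
field): `Φ(t,t',U) − μ n − h P_g`, i.e. the pencil `pencil (hubbardTTPrimeMuInteraction t t' U μ)
(pairSourceInteraction g) (−h)`; its local Hamiltonians are `H^{tt'}_Λ − μ N_Λ − h O_Λ` with `O_Λ` the
pair order operator of the region (all on-site pairs and nearest-neighbour bonds inside `Λ`). For
`t' = 0`, `g = dWaveFormFactor` these are free-boundary versions of the tree's `dWaveSourceTorus` /
`pairSourceWindowHamiltonian`. [cite: KomaTasaki1994, §1] -/
def hubbardTTPrimeSourcedInteraction (t t' U μ : ℝ) (g : Site 2 → ℝ) (h : ℝ) : FermionInteraction 2 :=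
  FermionInteraction.pencil (hubbardTTPrimeMuInteraction t t' U μ) (pairSourceInteraction g) (-h)

variable (t t' U μ : ℝ) (g : Site 2 → ℝ) (h : ℝ)

/-- The terms of the sourced interaction (definitional). [cite: KomaTasaki1994, §1] -/
theorem hubbardTTPrimeSourcedInteraction_apply (X : Finset (Site 2)) :
    (hubbardTTPrimeSourcedInteraction t t' U μ g h).Φ X =
      (hubbardTTPrimeMuInteraction t t' U μ).Φ X + ((-h : ℝ) : ℂ) • (pairSourceInteraction g).Φ X := rfl

/-- The sourced interaction is even (the source breaks `U(1)` but not fermion parity).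
[cite: ArakiMoriya2003, §1 assumption (II)] -/
theorem hubbardTTPrimeSourcedInteraction_isEven : (hubbardTTPrimeSourcedInteraction t t' U μ g h).IsEven :=
  FermionInteraction.isEven_pencil (hubbardTTPrimeMuInteraction_isEven t t' U μ) (pairSourceInteraction_isEven g) _

/-- The sourced interaction is Hermitian. [cite: ArakiMoriya2003, §1 assumption (II)] -/
theorem hubbardTTPrimeSourcedInteraction_isHermitian :
    (hubbardTTPrimeSourcedInteraction t t' U μ g h).IsHermitian :=
  FermionInteraction.isHermitian_pencil (hubbardTTPrimeMuInteraction_isHermitian t t' U μ)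
    (pairSourceInteraction_isHermitian g) _

/-- **The local Hamiltonians of the sourced model**: `H^{src}_Λ = (H^{tt'}_Λ + (−μ) N_Λ) + (−h) O_Λ`.
[cite: KomaTasaki1994, §1] -/
theorem hubbardTTPrimeSourcedInteraction_localHamiltonian (Λ : Finset (Site 2)) :
    (hubbardTTPrimeSourcedInteraction t t' U μ g h).localHamiltonian Λ =
      (hubbardTTPrimeMuInteraction t t' U μ).localHamiltonian Λ +
        ((-h : ℝ) : ℂ) • (pairSourceInteraction g).localHamiltonian Λ :=
  FermionInteraction.localHamiltonian_pencil _ _ _ Λ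

namespace InfVolFermionState

/-- **The mean energy of the sourced model**: `e^{src}_h(ω) = e^{tt'}(ω) − μ ρ(ω) − h e_P(ω)`, `e_P(ω)`
the pair-source energy density (induced pair amplitude) of `ω`. [cite: KomaTasaki1994, §1] -/
theorem meanEnergy_hubbardTTPrimeSourced (ω : InfVolFermionState 2) :
    ω.meanEnergy (hubbardTTPrimeSourcedInteraction t t' U μ g h) 1 =
      ω.meanEnergy (hubbardTTPrimeFermionInteraction t t' U) 1 - μ * ω.density -
        h * ω.meanEnergy (pairSourceInteraction g) 1 := by
  rw [hubbardTTPrimeSourcedInteraction, meanEnergy_pencil, meanEnergy_hubbardTTPrimeMu]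
  ring

variable {t t' U μ g h}

/-- **FLOOR on the induced pair amplitude from the LEFT neighbour** (every state): if
`lo ≤ e^{src}_{h−δ}(ω)` (a lower bound valid for `ω` at the SMALLER source `h − δ`, e.g. a certified
lower bound over all translation-invariant states — at `h − δ = 0` the source-FREE model) and
`e^{src}_h(ω) ≤ hi`, `δ > 0`, then `(lo − hi)/δ ≤ e_P(ω)`. Griffiths (1966) §II; Koma–Tasaki (1994) §1;
Kaplan–Horsch–von der Linden (1989). [cite: Griffiths1966, §II] -/
theorem div_le_pairAmplitude_of_bounds (ω : InfVolFermionState 2) {δ lo hi : ℝ} (hδ : 0 < δ)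
    (hlo : lo ≤ ω.meanEnergy (hubbardTTPrimeSourcedInteraction t t' U μ g (h - δ)) 1)
    (hhi : ω.meanEnergy (hubbardTTPrimeSourcedInteraction t t' U μ g h) 1 ≤ hi) :
    (lo - hi) / δ ≤ ω.meanEnergy (pairSourceInteraction g) 1 := by
  unfold hubbardTTPrimeSourcedInteraction at hlo hhi
  rw [show -(h - δ) = -h + δ by ring] at hlo
  exact ω.div_le_meanEnergy_of_bounds _ _ (-h) 1 hδ hlo hhi

/-- **CEILING on the induced pair amplitude from the RIGHT neighbour** (every state): if
`lo ≤ e^{src}_{h+δ}(ω)` and `e^{src}_h(ω) ≤ hi`, `δ > 0`, then `e_P(ω) ≤ (hi − lo)/δ`.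
[cite: Griffiths1966, §II] -/
theorem pairAmplitude_le_div_of_bounds (ω : InfVolFermionState 2) {δ lo hi : ℝ} (hδ : 0 < δ)
    (hlo : lo ≤ ω.meanEnergy (hubbardTTPrimeSourcedInteraction t t' U μ g (h + δ)) 1)
    (hhi : ω.meanEnergy (hubbardTTPrimeSourcedInteraction t t' U μ g h) 1 ≤ hi) :
    ω.meanEnergy (pairSourceInteraction g) 1 ≤ (hi - lo) / δ := by
  unfold hubbardTTPrimeSourcedInteraction at hlo hhi
  rw [show -(h + δ) = -h - δ by ring] at hlo
  exact ω.meanEnergy_le_div_of_bounds _ _ (-h) 1 hδ hlo hhi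

/-- **Two-sided bracket on the induced pair amplitude of a translation-invariant state from three
certified numbers**: lower bounds `lo₋`, `lo₊` over all translation-invariant states at the sources
`h − δ`, `h + δ` and an upper bound `hi` on the state's own sourced mean energy at `h` give
`(lo₋ − hi)/δ ≤ e_P(ω) ≤ (hi − lo₊)/δ`. [cite: Griffiths1966, §II] -/
theorem pairAmplitude_mem_Icc_of_bounds (ω : InfVolFermionState 2) (hω : ω.IsTranslationInvariant)
    {δ loMinus loPlus hi : ℝ} (hδ : 0 < δ)
    (hloMinus : ∀ ω' : InfVolFermionState 2, ω'.IsTranslationInvariant →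
      loMinus ≤ ω'.meanEnergy (hubbardTTPrimeSourcedInteraction t t' U μ g (h - δ)) 1)
    (hloPlus : ∀ ω' : InfVolFermionState 2, ω'.IsTranslationInvariant →
      loPlus ≤ ω'.meanEnergy (hubbardTTPrimeSourcedInteraction t t' U μ g (h + δ)) 1)
    (hhi : ω.meanEnergy (hubbardTTPrimeSourcedInteraction t t' U μ g h) 1 ≤ hi) :
    ω.meanEnergy (pairSourceInteraction g) 1 ∈ Set.Icc ((loMinus - hi) / δ) ((hi - loPlus) / δ) :=
  ⟨ω.div_le_pairAmplitude_of_bounds hδ (hloMinus ω hω) hhi,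
    ω.pairAmplitude_le_div_of_bounds hδ (hloPlus ω hω) hhi⟩

/-- **Secant brackets for a minimiser of the sourced model** (every translation-invariant ground
state in the sense of mean-energy minimisation at source `h`): for `δ > 0`,
`(e₀(h−δ) − e₀(h))/δ ≤ e_P(ω) ≤ (e₀(h) − e₀(h+δ))/δ`, `e₀(·) = tiGroundEnergyDensity` of the sourced
interaction (concave and non-increasing in `h ≥ 0` direction of growth of `e_P`). Koma–Tasaki (1994) §1;
Griffiths (1966) §II. [cite: KomaTasaki1994, §1] -/
theorem IsMeanEnergyMinimiser.pairAmplitude_mem_secant_brackets {ω : InfVolFermionState 2}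
    (hmin : ω.IsMeanEnergyMinimiser (hubbardTTPrimeSourcedInteraction t t' U μ g h) 1) {δ : ℝ} (hδ : 0 < δ) :
    ((hubbardTTPrimeSourcedInteraction t t' U μ g (h - δ)).tiGroundEnergyDensity 1 -
          (hubbardTTPrimeSourcedInteraction t t' U μ g h).tiGroundEnergyDensity 1) / δ ≤
        ω.meanEnergy (pairSourceInteraction g) 1 ∧
      ω.meanEnergy (pairSourceInteraction g) 1 ≤
        ((hubbardTTPrimeSourcedInteraction t t' U μ g h).tiGroundEnergyDensity 1 -
          (hubbardTTPrimeSourcedInteraction t t' U μ g (h + δ)).tiGroundEnergyDensity 1) / δ := by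
  unfold hubbardTTPrimeSourcedInteraction at hmin ⊢
  have h1 := hmin.secant_right_le_meanEnergy hδ
  have h2 := hmin.meanEnergy_le_secant_left hδ
  rw [show -h + δ = -(h - δ) by ring] at h1
  rw [show -h - δ = -(h + δ) by ring] at h2
  exact ⟨h1, h2⟩

/-- **Certified brackets for a minimiser of the sourced model**: certified lower bounds `lo∓` over
all translation-invariant states at the sources `h ∓ δ` and a certified upper bound `hi ≥ e₀(h)` (the
sourced mean energy of ANY translation-invariant trial state at source `h`) bracket the induced pair
amplitude of every minimiser at `h`: `(lo₋ − hi)/δ ≤ e_P(ω) ≤ (hi − lo₊)/δ`. With `δ = h` the floor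
reads `(lo(0) − hi(h))/h ≤ e_P(ω)` — a source-FREE certified lower bound and ONE sourced variational
upper bound. [cite: Griffiths1966, §II] -/
theorem IsMeanEnergyMinimiser.pairAmplitude_mem_Icc_of_bounds {ω : InfVolFermionState 2}
    (hmin : ω.IsMeanEnergyMinimiser (hubbardTTPrimeSourcedInteraction t t' U μ g h) 1)
    {δ loMinus loPlus hi : ℝ} (hδ : 0 < δ)
    (hloMinus : ∀ ω' : InfVolFermionState 2, ω'.IsTranslationInvariant →
      loMinus ≤ ω'.meanEnergy (hubbardTTPrimeSourcedInteraction t t' U μ g (h - δ)) 1)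
    (hloPlus : ∀ ω' : InfVolFermionState 2, ω'.IsTranslationInvariant →
      loPlus ≤ ω'.meanEnergy (hubbardTTPrimeSourcedInteraction t t' U μ g (h + δ)) 1)
    (hhi : (hubbardTTPrimeSourcedInteraction t t' U μ g h).tiGroundEnergyDensity 1 ≤ hi) :
    ω.meanEnergy (pairSourceInteraction g) 1 ∈ Set.Icc ((loMinus - hi) / δ) ((hi - loPlus) / δ) :=
  ω.pairAmplitude_mem_Icc_of_bounds hmin.1 hδ hloMinus hloPlus (hmin.meanEnergy_eq.trans_le hhi)

/-- **The induced pair amplitude is non-decreasing in the source along minimisers**: if `ω` minimises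
at `h`, `ω'` at `h'` and `h < h'`, then `e_P(ω) ≤ e_P(ω')` (the finite-volume tracial version is
`DWaveSourceProofs`' monotonicity of `dWaveSourceDensity`). Koma–Tasaki (1994) §1; Griffiths (1966) §II.
[cite: KomaTasaki1994, §1] -/
theorem IsMeanEnergyMinimiser.pairAmplitude_mono {ω ω' : InfVolFermionState 2} {h' : ℝ}
    (hmin : ω.IsMeanEnergyMinimiser (hubbardTTPrimeSourcedInteraction t t' U μ g h) 1)
    (hmin' : ω'.IsMeanEnergyMinimiser (hubbardTTPrimeSourcedInteraction t t' U μ g h') 1) (hhh' : h < h') :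
    ω.meanEnergy (pairSourceInteraction g) 1 ≤ ω'.meanEnergy (pairSourceInteraction g) 1 := by
  unfold hubbardTTPrimeSourcedInteraction at hmin hmin'
  exact hmin'.meanEnergy_antitone hmin (neg_lt_neg hhh')

/-- **The sourced ground-state energy density is concave in the source** `h`.
Koma–Tasaki (1994) §1. [cite: KomaTasaki1994, §1] -/
theorem concaveOn_tiGroundEnergyDensity_sourced :
    ConcaveOn ℝ Set.univ fun h : ℝ => (hubbardTTPrimeSourcedInteraction t t' U μ g h).tiGroundEnergyDensity 1 := by
  have hc := FermionInteraction.concaveOn_tiGroundEnergyDensity_pencil (hubbardTTPrimeMuInteraction t t' U μ)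
    (pairSourceInteraction g) 1
  refine ⟨convex_univ, fun x _ y _ a b ha hb hab => ?_⟩
  have := hc.2 (Set.mem_univ (-x)) (Set.mem_univ (-y)) ha hb hab
  simp only [smul_eq_mul, mul_neg, ← neg_add] at this
  simpa only [hubbardTTPrimeSourcedInteraction, smul_eq_mul] using this

end InfVolFermionState

end Sourced

/-! ### §8. Dictionary: the pair amplitude `e_P(ω)` is the expectation of the local pair operator
`P₀ + P₀ᴴ` at the origin (`P₀ = localPairAt ({0} ∪ unitSteps) g 0`, the tree's infinite-lattice local
pair, whose torus image is `localPair g L 0` and whose correlations are `pairCorr` / `dWavePairCorr`) -/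

section PairAmplitudeDictionary

/-- **Singlet symmetry**: `b_{y,x} = b_{x,y}` (`c_{y↑}c_{x↓} − c_{y↓}c_{x↑} = c_{x↑}c_{y↓} − c_{x↓}c_{y↑}`
by the CAR `c_i c_j = −c_j c_i`). Bratteli–Robinson II §5.2.2 (5.2.11); Scalapino (1995) §2.
[cite: BratteliRobinsonII1997, §5.2.2] -/
theorem singletPairAt_comm {X : Finset (Site d)} (x y : Site d) (hx : x ∈ X) (hy : y ∈ X) :
    singletPairAt y x hy hx = singletPairAt x y hx hy := by
  have h1 : cAt y hy 0 * cAt x hx 1 = -(cAt x hx 1 * cAt y hy 0) :=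
    eq_neg_of_add_eq_zero_left (annihilation_anticommute_holds _ _)
  have h2 : cAt y hy 1 * cAt x hx 0 = -(cAt x hx 0 * cAt y hy 1) :=
    eq_neg_of_add_eq_zero_left (annihilation_anticommute_holds _ _)
  rw [singletPairAt, singletPairAt, h1, h2]
  abel

/-- `b_{x,y}` only depends on the sites (transport of the membership proofs).
[cite: BratteliRobinsonII1997, §5.2.2] -/
theorem singletPairAt_congr {X : Finset (Site d)} {x x' y y' : Site d} (hx : x ∈ X) (hy : y ∈ X)
    (hx' : x' ∈ X) (hy' : y' ∈ X) (h₁ : x = x') (h₂ : y = y') :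
    singletPairAt x y hx hy = singletPairAt x' y' hx' hy' := by
  subst h₁ h₂
  rfl

/-- Isotony on singlet pairs: `Γ(X ⊆ Y) b_{x,y} = b_{x,y}`. [cite: BratteliRobinsonII1997, §5.2.2] -/
theorem fermionEmbed_incl_singletPairAt {X Y : Finset (Site d)} (h : X ⊆ Y) (x y : Site d) (hx : x ∈ X)
    (hy : y ∈ X) :
    fermionEmbed (PolySite.incl h) (singletPairAt x y hx hy) = singletPairAt x y (h hx) (h hy) := by
  rw [singletPairAt, singletPairAt, map_sub, map_mul, map_mul, fermionEmbed_incl_cAt, fermionEmbed_incl_cAt,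
    fermionEmbed_incl_cAt, fermionEmbed_incl_cAt]

namespace InfVolFermionState

/-- `Re ω(B + Bᴴ) = 2 Re ω(B)` (states are Hermitian). [cite: BratteliRobinsonI1987, §2.3.2] -/
theorem re_expect_add_conjTranspose (ω : InfVolFermionState d) (Λ : Finset (Site d)) (B : FermionOp Λ) :
    (ω.expect Λ (B + Bᴴ)).re = 2 * (ω.expect Λ B).re := by
  rw [map_add, ω.expect_conjTranspose, Complex.add_re, Complex.star_def, Complex.conj_re]
  ring

end InfVolFermionState

/-- `e_i ∈ {0} ∪ unitSteps`. [folklore] -/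
private theorem unitVec_mem_insert_zero_unitSteps (i : Fin 2) :
    (unitVec i : Site 2) ∈ insert (0 : Site 2) unitSteps := by
  refine Finset.mem_insert_of_mem ?_
  fin_cases i <;> simp [unitSteps, unitVec]

/-- `-e_i ∈ {0} ∪ unitSteps`. [folklore] -/
private theorem neg_unitVec_mem_insert_zero_unitSteps (i : Fin 2) :
    (-unitVec i : Site 2) ∈ insert (0 : Site 2) unitSteps := by
  refine Finset.mem_insert_of_mem ?_
  fin_cases i <;> simp [unitSteps, unitVec]

/-- A sum over `{0} ∪ unitSteps`, expanded over `0, e₁, −e₁, e₂, −e₂`. [folklore] -/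
private theorem sum_insert_zero_unitSteps' {M : Type*} [AddCommMonoid M] (f : Site 2 → M) :
    ∑ e ∈ insert (0 : Site 2) unitSteps, f e =
      f 0 + (f (unitVec 0) + (f (-unitVec 0) + (f (unitVec 1) + f (-unitVec 1)))) := by
  have h0 : (0 : Site 2) ∉ unitSteps := by
    simp only [unitSteps, Finset.mem_insert, Finset.mem_singleton]; decide
  have h1 : (Pi.single 0 1 : Site 2) ∉
      ({-Pi.single 0 1, Pi.single 1 1, -Pi.single 1 1} : Finset (Site 2)) := by
    simp only [Finset.mem_insert, Finset.mem_singleton]; decide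
  have h2 : (-Pi.single 0 1 : Site 2) ∉ ({Pi.single 1 1, -Pi.single 1 1} : Finset (Site 2)) := by
    simp only [Finset.mem_insert, Finset.mem_singleton]; decide
  have h3 : (Pi.single 1 1 : Site 2) ∉ ({-Pi.single 1 1} : Finset (Site 2)) := by
    simp only [Finset.mem_singleton]; decide
  rw [Finset.sum_insert h0, unitSteps, Finset.sum_insert h1, Finset.sum_insert h2, Finset.sum_insert h3,
    Finset.sum_singleton]

namespace InfVolFermionState

/-- **The pair amplitude is the expectation of the local pair operator at the origin**: for a form factor
even on the unit steps (`g(−e_i) = g(e_i)`; e.g. `dWaveFormFactor`, `extendedSWave`, `sWave`) and EVERY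
state `ω`, `e_P(ω) = meanEnergy (pairSourceInteraction g) 1 ω = 2 Re ω(P₀) = Re ω(P₀ + P₀ᴴ)`,
`P₀ = localPairAt ({0} ∪ unitSteps) g 0 = Σ_{e ∈ {0,±e₁,±e₂}} (g(e)/√2) b_{0,e}` — the Koma–Tasaki
order-operator density `ω(O_Λ)/|Λ|` of the pair field `Δ_g + Δ_g†` (every bond shared by its two ends).
[cite: KomaTasaki1994, §1] -/
theorem meanEnergy_pairSourceInteraction_eq_two_mul_re_expect_localPairAt (g : Site 2 → ℝ)
    (hg : ∀ i : Fin 2, g (-unitVec i) = g (unitVec i)) (ω : InfVolFermionState 2) :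
    ω.meanEnergy (pairSourceInteraction g) 1 =
      2 * (ω.expect (pairRegion (insert 0 unitSteps) 0) (localPairAt (insert 0 unitSteps) g 0)).re := by
  set S₀ : Finset (Site 2) := insert 0 unitSteps with hS₀
  set R : Finset (Site 2) := pairRegion S₀ 0 with hR
  have h0R : (0 : Site 2) ∈ R := self_mem_pairRegion S₀ 0
  have haddR : ∀ {e : Site 2}, e ∈ S₀ → 0 + e ∈ R := fun he => add_mem_pairRegion 0 he
  have heR : ∀ i : Fin 2, (unitVec i : Site 2) ∈ R := fun i => by
    simpa only [zero_add] using haddR (unitVec_mem_insert_zero_unitSteps i)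
  have hneR : ∀ i : Fin 2, (-unitVec i : Site 2) ∈ R := fun i => by
    simpa only [zero_add] using haddR (neg_unitVec_mem_insert_zero_unitSteps i)
  -- the abbreviation `r y hy = Re ω_R(b_{0,y})`
  -- RIGHT-HAND SIDE: `2 Re ω(P₀) = Σ_e (g e/√2) · 2 Re ω_R(b_{0,0+e})`
  have hP : localPairAt S₀ g 0 =
      ∑ e ∈ S₀.attach, ((g e.1 / Real.sqrt 2 : ℝ) : ℂ) • singletPairAt 0 (0 + e.1) h0R (haddR e.2) := rfl
  set F : Site 2 → ℝ := fun e =>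
    if h : e ∈ S₀ then (g e / Real.sqrt 2) * (ω.expect R (singletPairAt 0 (0 + e) h0R (haddR h))).re else 0
    with hF
  have hRHS : (ω.expect R (localPairAt S₀ g 0)).re = ∑ e ∈ S₀, F e := by
    rw [hP, map_sum, Complex.re_sum, ← Finset.sum_attach S₀ F]
    refine Finset.sum_congr rfl fun e _ => ?_
    rw [map_smul, smul_eq_mul, Complex.re_ofReal_mul, hF]
    dsimp only
    rw [dif_pos e.2]
  -- LEFT-HAND SIDE: the three kinds of terms, transported into `𝔄_R`
  have hsub0 : ({0} : Finset (Site 2)) ⊆ R := Finset.singleton_subset_iff.2 h0R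
  have hsub1 : ∀ i : Fin 2, ({0, 0 + unitVec i} : Finset (Site 2)) ⊆ R := fun i => by
    refine Finset.insert_subset h0R (Finset.singleton_subset_iff.2 ?_)
    rw [zero_add]; exact heR i
  have hsub2 : ∀ i : Fin 2, ({-unitVec i, -unitVec i + unitVec i} : Finset (Site 2)) ⊆ R := fun i => by
    refine Finset.insert_subset (hneR i) (Finset.singleton_subset_iff.2 ?_)
    rw [neg_add_cancel]; exact h0R
  -- on-site term
  have hT0 : (ω.expect {0} ((pairSourceInteraction g).Φ {0})).re =
      (g 0 / Real.sqrt 2) * (2 * (ω.expect R (singletPairAt 0 0 h0R h0R)).re) := by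
    rw [pairSourceInteraction_apply_singleton, ← ω.compatible hsub0, map_smul, map_add,
      fermionEmbed_conjTranspose, fermionEmbed_incl_singletPairAt, map_smul, smul_eq_mul, Complex.re_ofReal_mul,
      re_expect_add_conjTranspose]
  have hb0 : singletPairAt 0 (0 + 0) h0R (haddR (Finset.mem_insert_self (0 : Site 2) unitSteps)) =
      singletPairAt 0 0 h0R h0R :=
    singletPairAt_congr _ _ _ _ rfl (zero_add 0)
  -- bond `{0, e_i}`
  have hT1 : ∀ i : Fin 2, (ω.expect {0, 0 + unitVec i} ((pairSourceInteraction g).Φ {0, 0 + unitVec i})).re =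
      (Real.sqrt 2 * g (unitVec i)) *
        (2 * (ω.expect R (singletPairAt 0 (0 + unitVec i) h0R (haddR (unitVec_mem_insert_zero_unitSteps i)))).re) := by
    intro i
    rw [pairSourceInteraction_apply_pair, ← ω.compatible (hsub1 i), map_smul, map_add,
      fermionEmbed_conjTranspose, fermionEmbed_incl_singletPairAt, map_smul, smul_eq_mul, Complex.re_ofReal_mul,
      re_expect_add_conjTranspose]
  -- bond `{-e_i, 0}`: `b_{-e_i, -e_i + e_i} = b_{0, 0 + (-e_i)}` by singlet symmetry
  have hT2 : ∀ i : Fin 2,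
      (ω.expect {-unitVec i, -unitVec i + unitVec i}
        ((pairSourceInteraction g).Φ {-unitVec i, -unitVec i + unitVec i})).re =
      (Real.sqrt 2 * g (unitVec i)) *
        (2 * (ω.expect R (singletPairAt 0 (0 + -unitVec i) h0R (haddR (neg_unitVec_mem_insert_zero_unitSteps i)))).re) := by
    intro i
    have hb2 : ∀ (p : -unitVec i ∈ R) (q : -unitVec i + unitVec i ∈ R),
        singletPairAt (-unitVec i) (-unitVec i + unitVec i) p q =
          singletPairAt 0 (0 + -unitVec i) h0R (haddR (neg_unitVec_mem_insert_zero_unitSteps i)) := by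
      intro p q
      calc singletPairAt (-unitVec i) (-unitVec i + unitVec i) p q
          = singletPairAt (0 + -unitVec i) 0 (haddR (neg_unitVec_mem_insert_zero_unitSteps i)) h0R :=
            singletPairAt_congr _ _ _ _ (zero_add _).symm (neg_add_cancel _)
        _ = singletPairAt 0 (0 + -unitVec i) h0R (haddR (neg_unitVec_mem_insert_zero_unitSteps i)) :=
            singletPairAt_comm 0 (0 + -unitVec i) h0R _
    rw [pairSourceInteraction_apply_pair, ← ω.compatible (hsub2 i), map_smul, map_add,
      fermionEmbed_conjTranspose, fermionEmbed_incl_singletPairAt, hb2, map_smul, smul_eq_mul,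
      Complex.re_ofReal_mul, re_expect_add_conjTranspose]
  -- assemble
  have hs2 : Real.sqrt 2 ^ 2 = 2 := Real.sq_sqrt zero_le_two
  have hs0 : Real.sqrt 2 ≠ 0 := by positivity
  rw [meanEnergy_pairSourceInteraction_eq, hRHS, sum_insert_zero_unitSteps', Fin.sum_univ_two, hT0, hT1, hT1,
    hT2, hT2]
  simp only [hF]
  rw [dif_pos (Finset.mem_insert_self (0 : Site 2) unitSteps), dif_pos (unitVec_mem_insert_zero_unitSteps 0),
    dif_pos (neg_unitVec_mem_insert_zero_unitSteps 0), dif_pos (unitVec_mem_insert_zero_unitSteps 1),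
    dif_pos (neg_unitVec_mem_insert_zero_unitSteps 1), hg 0, hg 1, hb0]
  field_simp
  rw [hs2]
  ring

/-- **`d`-wave case**: `e_{P_d}(ω) = 2 Re ω(P₀^d)`, `P₀^d = localPairAt ({0} ∪ unitSteps) dWaveFormFactor 0`
(the `d_{x²−y²}` local pair of `dWavePairCorr` / the sourced objective `Δ₀ + Δ₀ᴴ`).
[cite: KomaTasaki1994, §1] -/
theorem meanEnergy_pairSourceInteraction_dWave_eq (ω : InfVolFermionState 2) :
    ω.meanEnergy (pairSourceInteraction dWaveFormFactor) 1 =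
      2 * (ω.expect (pairRegion (insert 0 unitSteps) 0)
        (localPairAt (insert 0 unitSteps) dWaveFormFactor 0)).re :=
  ω.meanEnergy_pairSourceInteraction_eq_two_mul_re_expect_localPairAt dWaveFormFactor
    (fun i => dWaveFormFactor_neg (unitVec i))

end InfVolFermionState

end PairAmplitudeDictionary

/-! ### §9. The grand-canonical energy density below the canonical one: `e_GC(μ) ≤ e(t,t',U,n) − μn`
(the `hhi` slot of the `μ`-brackets from certified CANONICAL upper rows) -/

section GrandCanonicalCap

open ThermodynamicLimit

namespace FermionInteraction

/-- **The grand-canonical energy density lies below every canonical one**: for `U ≥ 0` and every density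
`n ∈ [0, 2)`, `e_GC(μ) := tiGroundEnergyDensity (Φ(t,t',U) − μn) 1 ≤ energyDensityTT' t t' U n − μ n`
(the torus limit of sector ground states at density `n` is a translation-invariant trial state with
`e^{tt'} = e(t,t',U,n)`, `exists_isTorusLimitOf_squareGroundStatesTT'_meanEnergy_eq`). Ruelle (1969) §3.4
(equivalence of ensembles at `T = 0`: `e_GC(μ) = inf_n (e(n) − μn)`; this is the easy half).
[cite: Ruelle1969, §3.4] -/
theorem tiGroundEnergyDensity_hubbardTTPrimeMu_le_energyDensityTT'_sub (t t' : ℝ) {U : ℝ} (hU : 0 ≤ U)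
    (μ : ℝ) {n : ℝ} (hn0 : 0 ≤ n) (hn2 : n < 2) :
    (hubbardTTPrimeMuInteraction t t' U μ).tiGroundEnergyDensity 1 ≤ energyDensityTT' t t' U n - μ * n := by
  obtain ⟨ψ, Ls, ω, -, -, hti, -, -, -, hdens, -, hmean⟩ :=
    exists_isTorusLimitOf_squareGroundStatesTT'_meanEnergy_eq (t := t) (t' := t') hU hn0 hn2
  have h := (hubbardTTPrimeMuInteraction t t' U μ).tiGroundEnergyDensity_le_meanEnergy 1 hti
  rwa [InfVolFermionState.meanEnergy_hubbardTTPrimeMu, hmean, hdens] at h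

/-- **Certified form**: a certified canonical UPPER row `energyDensityTT' t t' U n ≤ R` at any density
`n ∈ [0,2)` gives `e_GC(μ) ≤ R − μ n` at EVERY `μ` — the `hhi` input of
`IsMeanEnergyMinimiser.meanEnergy_mem_Icc_of_bounds` / `density_mem_Icc_of_groundState_of_bounds` for the
`μ`-pencil. [cite: Ruelle1969, §3.4] -/
theorem tiGroundEnergyDensity_hubbardTTPrimeMu_le_of_energyDensityTT'_le (t t' : ℝ) {U : ℝ} (hU : 0 ≤ U)
    (μ : ℝ) {n R : ℝ} (hn0 : 0 ≤ n) (hn2 : n < 2) (hR : energyDensityTT' t t' U n ≤ R) :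
    (hubbardTTPrimeMuInteraction t t' U μ).tiGroundEnergyDensity 1 ≤ R - μ * n :=
  (tiGroundEnergyDensity_hubbardTTPrimeMu_le_energyDensityTT'_sub t t' hU μ hn0 hn2).trans (by linarith)

/-- **Dually, a grand-canonical lower bound is a supporting line of the canonical density**: if
`lo ≤ e^{tt'}(ω') − μρ(ω')` for every translation-invariant `ω'` (e.g. a certified grand-canonical energy
floor at `μ`), then `lo + μ n ≤ energyDensityTT' t t' U n` for every `n ∈ [0, 2)` (`U ≥ 0`).
[cite: Ruelle1969, §3.4] -/
theorem add_mul_le_energyDensityTT'_of_forall_le_meanEnergy_hubbardTTPrimeMu (t t' : ℝ) {U : ℝ}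
    (hU : 0 ≤ U) (μ : ℝ) {lo : ℝ}
    (hlo : ∀ ω' : InfVolFermionState 2, ω'.IsTranslationInvariant →
      lo ≤ ω'.meanEnergy (hubbardTTPrimeMuInteraction t t' U μ) 1)
    {n : ℝ} (hn0 : 0 ≤ n) (hn2 : n < 2) : lo + μ * n ≤ energyDensityTT' t t' U n := by
  have h := ((hubbardTTPrimeMuInteraction t t' U μ).le_tiGroundEnergyDensity 1 hlo).trans
    (tiGroundEnergyDensity_hubbardTTPrimeMu_le_energyDensityTT'_sub t t' hU μ hn0 hn2)
  linarith

/-- **The sourced energy density never exceeds the canonical cap either** (the source can only LOWER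
the variational energy of the number-conserving minimiser IF its pair amplitude vanishes — here stated
without that input): for every translation-invariant `σ`,
`e₀^{src}(h) ≤ e^{tt'}(σ) − μρ(σ) − h·e_P(σ)`; in particular with a torus-limit canonical minimiser of
density `n` whose pair amplitude is `0` (gauge invariance — a hypothesis here),
`e₀^{src}(h) ≤ energyDensityTT' t t' U n − μ n` for every `h` (the "canonical → grand-canonical cap
bridge": a transported cap, which can feed a CEILING but never a positive floor).
[cite: KomaTasaki1994, §1] -/
theorem tiGroundEnergyDensity_sourced_le_of_pairAmplitude_eq_zero (t t' U μ : ℝ) (g : Site 2 → ℝ) (h : ℝ)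
    {σ : InfVolFermionState 2} (hσ : σ.IsTranslationInvariant)
    (hP : σ.meanEnergy (pairSourceInteraction g) 1 = 0) :
    (hubbardTTPrimeSourcedInteraction t t' U μ g h).tiGroundEnergyDensity 1 ≤
      σ.meanEnergy (hubbardTTPrimeFermionInteraction t t' U) 1 - μ * σ.density := by
  have h1 := (hubbardTTPrimeSourcedInteraction t t' U μ g h).tiGroundEnergyDensity_le_meanEnergy 1 hσ
  rwa [InfVolFermionState.meanEnergy_hubbardTTPrimeSourced, hP, mul_zero, sub_zero] at h1

end FermionInteraction

end GrandCanonicalCap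

end Literature.MathematicalPhysics.QuantumLattice

end
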